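import Literature.Geometry.Riemannian.GurskyViaclovskyC2Estimate
import Literature.Geometry.Riemannian.Sigma2ConformalFour
import Literature.Geometry.Lorentzian.WeylConformal
import Literature.Geometry.Riemannian.RicciFlowScalarMaximumPrinciple
import Literature.Geometry.Riemannian.RicciDeTurckChartFamily
import Literature.Geometry.Riemannian.ChangGurskyYangSmoothness
import Literature.Geometry.Lorentzian.DalembertianNaturality
import Literature.Geometry.Lorentzian.EndChartIntegral
import Literature.Geometry.Lorentzian.ChartMetricCoord
import Literature.Geometry.Lorentzian.ChartLaplacian
import Literature.Geometry.Lorentzian.CoordSigma2PathLocalEstimate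
import HarnessLib

/-!
# Gursky–Viaclovsky 2003, Prop. 6 (the `C²` estimate along the weighted `σ₂`-path): the path
# equation on the background metric, and the reduction of the Hessian bound to a Laplacian bound

Support file for the named fact
`Literature.Geometry.Riemannian.gurskyViaclovsky_hessianEstimate_weighted_four`
(`GurskyViaclovskyC2Estimate.lean`; Gursky–Viaclovsky, J. Differential Geom. 63 (2003), §5,
Prop. 6, whose printed proof is the pointer "The `C²` estimate follows from the global estimates
in [GVNegative], or the local estimates [GuanWang1] and [LiLi2] … the main fact used in deriving
these estimates is that `σ₂^{1/2}(A^t)` is a concave function of the second derivative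
variables"; the local estimate with an `x`- and `u`-dependent right-hand side is S. Chen,
IMRN 2005:63, Thm. 1 (a) and Cor. 2). The published proof (Chen 2005, §3) has two steps:

1. **Reduction to a Laplacian bound** (§3, first paragraph: "We will show that `Δu` is bounded.
   By the condition `Γ ⊂ Γ₁⁺` we have `0 < tr_g W = Δu + (a + nb)|∇u|² + tr_g B` … the Laplacian
   `Δu` has lower bound"; and `|W|² = (tr W)² − 2σ₂(W)` on the cone): a bound on `sup Δu`,
   together with the `C⁰` and `C¹` bounds, bounds the full Hessian.
2. **The Laplacian bound** by the maximum principle applied to `H = η(Δu + a|∇u|²)`, using the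
   once and twice differentiated equation, the concavity of `F`, and the Ricci identities.

This file PROVES step 1 in the tree's vocabulary (`GurskyViaclovskyPath.lean`:
`IsPathSolution g h u t q` = "`h = e^{−2u} g` Riemannian, `u ∈ C^∞`, `R_h > 0`,
`P_t(h) = σ₂(A_h) − ¼|W_h|² + (1−t)(2−t)R_h²/6 = q e^{8u}`") and reduces the named fact to
step 2:

* `exp_mul_pathOperator_conformal_exp_frame` — **the weighted path operator of `h = e^{2w} g` read
  on the background**, in a `g`-orthonormal frame `e` (`H_{ab} = Hess_g w(e_a,e_b)`,
  `b_a = dw(e_a)`, `Ric_{ab}`, `R = R_g`):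
  `e^{4w} P_t(h) = σ₂(A_g) + [2ΣRic_{ab}H_{ab} − RΣH_{aa}] + 2[(ΣH_{aa})² − ΣH_{ab}² − ΣRic_{ab}b_ab_b]
   + 2[(ΣH_{aa})Σb_a² + 2ΣH_{ab}b_ab_b] − ¼|W_g|² + (1−t)(2−t)(R − 6ΣH_{aa} − 6Σb_a²)²/6`
  — the three conformal laws of the tree: `exp_mul_sigma2WeylSchouten_conformal_exp_frame`
  (Chang–Gursky–Yang 2002, (0.4)), `scalarCurvature_conformal_exp_four` (Besse 1987, 1.159 (f))
  and `weylNormSq_conformal_sq` (Besse 1987, 1.159 (c));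
* `IsPathSolution.frame_identity` — for a path solution (`w = −u`, `P_t(h) = q e^{8u}`):
  **the path equation as a scalar identity for `Hess_g u`, `du` on `(M, g)`** — the tree's form
  of Gursky–Viaclovsky's `σ₂(g⁻¹A^t_u) = (1/16)|W_g|² + (q/4)e^{4u}` with
  `A^t_u = A^t_g + ∇²u + ((1−t)/2)(Δu)g + du⊗du − ((2−t)/2)|∇u|²g` (§1, (PDE) and (path));
* `sum_sq_le_of_frame_identity` (pure algebra) and `IsPathSolution.normSq_hessian_le` —
  **`|Hess_g u|²_g ≤ (7/3 + 12k)(Δ_g u)² + (2/3)(|σ₂(A_g)| + 5|Ric_g|² + (1+k)R_g²/2 + 18(1+k)|du|⁴_g)`**,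
  `k = (1−t)(2−t) ≥ 0` (`t ≤ 1`, `q ≥ 0`): the identity `|W|² = σ₁(W)² − 2σ₂(W)` of step 1 in
  the weighted setting, by AM–GM;
* `IsPathSolution.scalarCurvature_add_pos` — **`R_g + 6Δ_g u − 6|du|²_g > 0`** (admissibility
  `R_h > 0` read on `g`, Besse 1.159 (f)): the lower bound `Δ_g u > |du|²_g − R_g/6` of step 1;
* `exists_normSq_hessian_le_of_dalembertian_le` — **on a compact `M⁴`, a uniform upper bound on
  `Δ_g u` over the admissible solutions with `|du|²_g ≤ C₁` at parameters `t ∈ [δ, 1]` gives a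
  uniform bound on `|Hess_g u|²_g`** (constants from `max |σ₂(A_g)|, max |Ric_g|², max |R_g|`,
  continuity on the compact manifold);
* `hessianEstimate_of_dalembertianEstimate` — **the named fact follows from the Laplacian
  estimate** `sup_M Δ_g u ≤ C₃(M, g, q, δ, C₀, C₁)` for the same class of solutions.

Step 2 (the Laplacian estimate, Chen 2005, §3: the maximum principle for `Δu + |∇u|²`, once and
twice differentiated equation, concavity, Ricci identities) is carried out in coordinates in
`Literature/Geometry/Lorentzian/CoordSigma2LaplacianEstimate.lean` and packaged on a compact
coordinate set in `CoordSigma2PathLocalEstimate.lean`; the last part of this file reads the path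
equation in charts and assembles it on the compact manifold:

* `lapAt_chart`, `gradSqAt_chart`, `hessAt_chart`, `ricAt_chart`, `scalAt_chart`,
  `fderiv_chart`, `chartRep_apply_eq` — the chart dictionary for the components `chartRep` of the
  pulled-back metric (O'Neill 1983, Ch. 3, Prop. 3.59);
* `IsPathSolution.chart_equation` — **the path equation in a chart**:
  `½(c_t (tr_Ĝ W)² − |W|²_Ĝ) = (1/16)|W_g|² + (q/4)e^{4û}`, `c_t = 1 + 3(1−t)(2−t)`,
  `W = Hess û + dû⊗dû − ½|∇û|²Ĝ + ½(Ric_Ĝ − (R_Ĝ/6)Ĝ)` (from `IsPathSolution.frame_identity` and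
  the polynomial identity `MetricCoord.sigma2Path_frame_algebra`), and
  `IsPathSolution.mtrAt_chart_pos` — `tr_Ĝ W > 0`;
* `exists_nhds_dalembertian_le` (the local bound near a point) and
  `dalembertian_le_of_isPathSolution` (compactness: hypothesis `hΔ`);
* `gurskyViaclovsky_hessianEstimate_weighted_four_holds` — **the named fact, proved.**

Everything is proved; no definition and no named fact is introduced.

## References

* M. J. Gursky, J. A. Viaclovsky, *A fully nonlinear equation on four-manifolds with positive
  scalar curvature*, J. Differential Geom. 63 (2003) 131–154, arXiv:math/0301350: §1 ((PDE),
  `A^t`), §3 ((path)), §5, Prop. 6 and its proof. [GurskyViaclovsky2003]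
* S. Chen, *Local estimates for some fully nonlinear elliptic equations*, Int. Math. Res. Not.
  2005:63, 3403–3425, arXiv:math/0510652: Thm. 1 (a), Cor. 1–2, §3 (proof of Thm. 1, first
  paragraph and (i:grad1)). [Chen2005]
* S.-Y. A. Chang, M. J. Gursky, P. C. Yang, Ann. of Math. 155 (2002), (0.4). [ChangGurskyYang2002]
* A. L. Besse, *Einstein Manifolds*, Springer 1987, Thm. 1.159 (c), (f). [Besse1987]
* B. O'Neill, *Semi-Riemannian geometry*, Academic Press 1983, Ch. 3, Prop. 3.59. [ONeill1983]
-/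

noncomputable section


open Bundle Set Function Module
open scoped Manifold ContDiff Topology

namespace Literature.Geometry.Riemannian.GurskyViaclovskyPath

open Lorentzian Lorentzian.PseudoRiemannianMetric

section Frame

variable {M : Type*} [TopologicalSpace M] [ChartedSpace (EuclideanSpace ℝ (Fin 4)) M]
  [IsManifold (𝓡 4) ∞ M]
  (g h : PseudoRiemannianMetric (𝓡 4) ∞ (EuclideanSpace ℝ (Fin 4)) (TangentSpace (𝓡 4) : M → Type _))
  [g.HasLeviCivita] [h.HasLeviCivita]

/-- **The weighted path operator of a conformal metric, read on the background in a frame.**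
For `C^∞` metrics `g` (Riemannian) and `h = e^{2w} g` with their Levi-Civita connections on a
`4`-manifold, `w ∈ C^∞`, a parameter `t` and a `g_x`-orthonormal frame `e`, writing
`H_{ab} = Hess_g w(e_a,e_b)`, `b_a = dw(e_a)`, `Ric_{ab} = Ric_g(e_a,e_b)`, `R = R_g(x)`:
`e^{4w(x)} P_t(h)(x) = σ₂(A_g)(x) + [2ΣRic_{ab}H_{ab} − RΣH_{aa}]
 + 2[(ΣH_{aa})² − ΣH_{ab}² − ΣRic_{ab}b_ab_b] + 2[(ΣH_{aa})(Σb_a²) + 2ΣH_{ab}b_ab_b]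
 − ¼|W_g|²(x) + (1−t)(2−t)(R − 6ΣH_{aa} − 6Σb_a²)²/6`,
where `P_t(h) = σ₂(A_h) − ¼|W_h|² + (1−t)(2−t)R_h²/6` (`pathOperator`). The three summands are
the conformal laws `e^{4w}σ₂(A_h) = …` (`exp_mul_sigma2WeylSchouten_conformal_exp_frame`),
`R_h = e^{−2w}(R − 6Δ_g w − 6|dw|²)` (`scalarCurvature_conformal_exp_four`) and
`|W_h|²_h = e^{−4w}|W_g|²_g` (`weylNormSq_conformal_sq`), with `Δ_g w = ΣH_{aa}`, `|dw|² = Σb_a²`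
in the frame. This is the dictionary "`P_t(e^{−2u}g) = 4e^{4u}[σ₂(g⁻¹A^t_u) − (1/16)|W_g|²_g]`"
of `GurskyViaclovskyPath.lean` made quantitative (Gursky–Viaclovsky 2003, §1: the law
`A^t_{g̃} = A^t_g + ∇²u + ((1−t)/2)(Δu)g + du⊗du − ((2−t)/2)|∇u|²g` for `g̃ = e^{−2u}g`).
[cite: GurskyViaclovsky2003, §1 (A^t and its conformal law) and §3 (path)]
[cite: ChangGurskyYang2002, (0.4)] [cite: Besse1987, Thm. 1.159 (c), (f)] -/
theorem exp_mul_pathOperator_conformal_exp_frame (hg : g.IsRiemannian) {w : M → ℝ}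
    (hw : ContMDiff (𝓡 4) 𝓘(ℝ) ∞ w)
    (hgh : ∀ (x : M) (v v' : TangentSpace (𝓡 4) x), h.val x v v' = Real.exp (2 * w x) * g.val x v v')
    (t : ℝ) {x : M} {e : Fin 4 → TangentSpace (𝓡 4) x} (he : g.IsOrthonormalFrame x e) :
    Real.exp (4 * w x) * pathOperator h t x =
      g.sigma2WeylSchouten x
      + (2 * ∑ a, ∑ b, g.ricci x (e a) (e b) * g.hessian w x (e a) (e b)
          - g.scalarCurvature x * ∑ a, g.hessian w x (e a) (e a))
      + 2 * ((∑ a, g.hessian w x (e a) (e a)) ^ 2 - ∑ a, ∑ b, g.hessian w x (e a) (e b) ^ 2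
          - ∑ a, ∑ b, g.ricci x (e a) (e b) * (mvfderiv (𝓡 4) w x (e a) * mvfderiv (𝓡 4) w x (e b)))
      + 2 * ((∑ a, g.hessian w x (e a) (e a)) * (∑ a, mvfderiv (𝓡 4) w x (e a) ^ 2)
          + 2 * ∑ a, ∑ b, g.hessian w x (e a) (e b) *
              (mvfderiv (𝓡 4) w x (e a) * mvfderiv (𝓡 4) w x (e b)))
      - 1 / 4 * g.weylNormSq x
      + (1 - t) * (2 - t) * (g.scalarCurvature x - 6 * ∑ a, g.hessian w x (e a) (e a)
          - 6 * ∑ a, mvfderiv (𝓡 4) w x (e a) ^ 2) ^ 2 / 6 := by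
  classical
  have hE : finrank ℝ (EuclideanSpace ℝ (Fin 4)) = 4 := finrank_euclideanSpace_fin
  have hι : Fintype.card (Fin 4) = finrank ℝ (EuclideanSpace ℝ (Fin 4)) := by
    rw [Fintype.card_fin, hE]
  -- frame dictionary for `Δ_g w` and `|dw|²`
  have hO : (g.toBilinForm x).IsOrthoᵢ (he.toBasis hι) := by
    intro i j hij
    rw [he.coe_toBasis hι]
    exact he.2 i j hij
  have hcne : ∀ i, g.val x (he.toBasis hι i) (he.toBasis hι i) ≠ 0 := fun i ↦ by
    rw [he.coe_toBasis hι, he.1 i]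
    exact one_ne_zero
  have hΔ : g.dalembertian w x = ∑ a, g.hessian w x (e a) (e a) := by
    unfold PseudoRiemannianMetric.dalembertian
    rw [g.trace_eq_sum_of_isOrthonormalFrame (he.toBasis hι) (by rw [he.coe_toBasis hι]; exact he)]
    simp only [he.coe_toBasis hι]
  have hgrad : g.innerDual x (mvfderiv (𝓡 4) w x).toLinearMap (mvfderiv (𝓡 4) w x).toLinearMap =
      ∑ a, mvfderiv (𝓡 4) w x (e a) ^ 2 := by
    rw [g.innerDual_eq_sum_of_isOrthoᵢ x (he.toBasis hι) hO hcne]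
    refine Finset.sum_congr rfl fun a _ ↦ ?_
    rw [he.coe_toBasis hι, he.1 a, div_one, sq]
    rfl
  -- the three conformal laws
  have hσ := exp_mul_sigma2WeylSchouten_conformal_exp_frame g h hw hgh he
  have hR : h.scalarCurvature x = (Real.exp (2 * w x))⁻¹ * (g.scalarCurvature x
      - 6 * ∑ a, g.hessian w x (e a) (e a) - 6 * ∑ a, mvfderiv (𝓡 4) w x (e a) ^ 2) := by
    rw [g.scalarCurvature_conformal_exp_four h hE hw hgh x, hΔ, hgrad]
  have hψ : ContMDiff (𝓡 4) 𝓘(ℝ) ∞ (fun y ↦ Real.exp (w y)) :=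
    fun y ↦ Real.contDiff_exp.contDiffAt.comp_contMDiffAt (hw y)
  have hψpos : ∀ y, 0 < Real.exp (w y) := fun y ↦ Real.exp_pos _
  have hgh' : ∀ (y : M) (v v' : TangentSpace (𝓡 4) y),
      h.val y v v' = Real.exp (w y) ^ 2 * g.val y v v' := by
    intro y v v'
    rw [hgh y v v', sq, ← Real.exp_add]
    congr 1
    ring
  have h3 : 3 ≤ finrank ℝ (EuclideanSpace ℝ (Fin 4)) := by rw [hE]; norm_num
  have hW : h.weylNormSq x = (Real.exp (w x) ^ 4)⁻¹ * g.weylNormSq x :=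
    weylNormSq_conformal_sq h3 g h hg hψ hψpos hgh' x
  -- `e^{4w} R_h² = (R − 6Δw − 6|dw|²)²` and `e^{4w}|W_h|² = |W_g|²`
  have he4 : Real.exp (4 * w x) * (Real.exp (2 * w x))⁻¹ ^ 2 = 1 := by
    rw [← Real.exp_neg, ← Real.exp_nat_mul, ← Real.exp_add]
    convert Real.exp_zero using 2
    push_cast
    ring
  have he4' : Real.exp (4 * w x) * (Real.exp (w x) ^ 4)⁻¹ = 1 := by
    rw [← Real.exp_nat_mul, ← Real.exp_neg, ← Real.exp_add]
    convert Real.exp_zero using 2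
    push_cast
    ring
  unfold pathOperator
  rw [hR, hW]
  set S := g.scalarCurvature x - 6 * ∑ a, g.hessian w x (e a) (e a)
      - 6 * ∑ a, mvfderiv (𝓡 4) w x (e a) ^ 2 with hS
  have : Real.exp (4 * w x) * (h.sigma2WeylSchouten x
      - 1 / 4 * ((Real.exp (w x) ^ 4)⁻¹ * g.weylNormSq x)
      + (1 - t) * (2 - t) * ((Real.exp (2 * w x))⁻¹ * S) ^ 2 / 6)
      = Real.exp (4 * w x) * h.sigma2WeylSchouten x
        - 1 / 4 * (Real.exp (4 * w x) * (Real.exp (w x) ^ 4)⁻¹) * g.weylNormSq x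
        + (1 - t) * (2 - t) * (Real.exp (4 * w x) * (Real.exp (2 * w x))⁻¹ ^ 2) * S ^ 2 / 6 := by
    ring
  rw [this, he4, he4', hσ, hgrad]
  ring

/-- **The weighted path equation as a scalar identity for `Hess_g u` and `du` on the background**
(Gursky–Viaclovsky 2003, (path) of §3 with the Weyl weight, i.e.
`σ₂(g⁻¹A^t_u) = (1/16)|W_g|²_g + (q/4)e^{4u}`, multiplied out in a `g_x`-orthonormal frame `e`):
for a path solution `h = e^{−2u} g` at parameter `t` with right-hand side `q`, writing
`H_{ab} = Hess_g u(e_a,e_b)`, `d_a = du(e_a)`, `Ric_{ab} = Ric_g(e_a,e_b)`, `R = R_g(x)`,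
`q(x)e^{4u(x)} = σ₂(A_g)(x) − [2ΣRic_{ab}H_{ab} − RΣH_{aa}] + 2[(ΣH_{aa})² − ΣH_{ab}² − ΣRic_{ab}d_ad_b]
 − 2[(ΣH_{aa})(Σd_a²) + 2ΣH_{ab}d_ad_b] − ¼|W_g|²(x) + (1−t)(2−t)(R + 6ΣH_{aa} − 6Σd_a²)²/6`
(`exp_mul_pathOperator_conformal_exp_frame` with `w = −u`, `Hess(−u) = −Hess u`, `d(−u) = −du`,
and `e^{−4u}·q e^{8u} = q e^{4u}`). [cite: GurskyViaclovsky2003, §3 (path) and §1 (PDE)] -/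
theorem IsPathSolution.frame_identity {u : M → ℝ} {t : ℝ} {q : M → ℝ}
    (hs : IsPathSolution g h u t q) {x : M} {e : Fin 4 → TangentSpace (𝓡 4) x}
    (he : g.IsOrthonormalFrame x e) :
    q x * Real.exp (4 * u x) =
      g.sigma2WeylSchouten x
      - (2 * ∑ a, ∑ b, g.ricci x (e a) (e b) * g.hessian u x (e a) (e b)
          - g.scalarCurvature x * ∑ a, g.hessian u x (e a) (e a))
      + 2 * ((∑ a, g.hessian u x (e a) (e a)) ^ 2 - ∑ a, ∑ b, g.hessian u x (e a) (e b) ^ 2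
          - ∑ a, ∑ b, g.ricci x (e a) (e b) * (mvfderiv (𝓡 4) u x (e a) * mvfderiv (𝓡 4) u x (e b)))
      - 2 * ((∑ a, g.hessian u x (e a) (e a)) * (∑ a, mvfderiv (𝓡 4) u x (e a) ^ 2)
          + 2 * ∑ a, ∑ b, g.hessian u x (e a) (e b) *
              (mvfderiv (𝓡 4) u x (e a) * mvfderiv (𝓡 4) u x (e b)))
      - 1 / 4 * g.weylNormSq x
      + (1 - t) * (2 - t) * (g.scalarCurvature x + 6 * ∑ a, g.hessian u x (e a) (e a)
          - 6 * ∑ a, mvfderiv (𝓡 4) u x (e a) ^ 2) ^ 2 / 6 := by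
  have hg : g.IsRiemannian := hs.isRiemannian_background
  have hu : ContMDiff (𝓡 4) 𝓘(ℝ) ∞ u := hs.contMDiff
  have hw : ContMDiff (𝓡 4) 𝓘(ℝ) ∞ (-u) := hu.neg
  have hgh : ∀ (y : M) (v v' : TangentSpace (𝓡 4) y),
      h.val y v v' = Real.exp (2 * (-u) y) * g.val y v v' := by
    intro y v v'
    rw [hs.val_eq y v v', Pi.neg_apply]
    congr 1
    ring_nf
  have key := exp_mul_pathOperator_conformal_exp_frame g h hg hw hgh t he
  rw [hs.pathOperator_eq x] at key
  have hlhs : Real.exp (4 * (-u) x) * (q x * Real.exp (8 * u x)) = q x * Real.exp (4 * u x) := by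
    rw [Pi.neg_apply, mul_left_comm, ← Real.exp_add]
    congr 2
    ring
  rw [hlhs] at key
  have hH : ∀ a b, g.hessian (-u) x (e a) (e b) = -g.hessian u x (e a) (e b) := by
    intro a b
    rw [g.hessian_neg u x]
    rfl
  have hd : ∀ a, mvfderiv (𝓡 4) (-u) x (e a) = -mvfderiv (𝓡 4) u x (e a) := by
    intro a
    rw [mvfderiv_neg]
    rfl
  simp only [hH, hd, neg_sq, mul_neg, neg_mul, neg_neg, Finset.sum_neg_distrib,
    sub_neg_eq_add] at key
  rw [key]
  ring

/-- **The weighted path equation as a scalar identity on the background, intrinsically**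
(the frame-free form of `IsPathSolution.frame_identity`; `⟨·,·⟩_g = innerBilin`, `|·|²_g = normSq`,
`Δ_g = dalembertian`, `∇u = ♯du`, `|du|²_g = gradSq`): for a path solution `h = e^{−2u} g` at
parameter `t` with right-hand side `q`, at every point
`q e^{4u} = σ₂(A_g) − [2⟨Ric_g, Hess_g u⟩_g − R_g Δ_g u] + 2[(Δ_g u)² − |Hess_g u|²_g − Ric_g(∇u,∇u)]
 − 2[Δ_g u |du|²_g + 2 Hess_g u(∇u,∇u)] − ¼|W_g|² + (1−t)(2−t)(R_g + 6Δ_g u − 6|du|²_g)²/6` —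
Gursky–Viaclovsky's `σ₂(g⁻¹A^t_u) = (1/16)|W_g|²_g + (q/4)e^{4u}` with
`A^t_u = A^t_g + ∇²u + ((1−t)/2)(Δu)g + du⊗du − ((2−t)/2)|∇u|²g` (§1), times `4`.
[cite: GurskyViaclovsky2003, §3 (path) and §1 (PDE)] [cite: ChangGurskyYang2002, (0.4)] -/
theorem IsPathSolution.identity {u : M → ℝ} {t : ℝ} {q : M → ℝ}
    (hs : IsPathSolution g h u t q) (x : M) :
    q x * Real.exp (4 * u x) =
      g.sigma2WeylSchouten x
      - (2 * g.innerBilin x (g.ricci x) (g.hessian u x)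
          - g.scalarCurvature x * g.dalembertian u x)
      + 2 * (g.dalembertian u x ^ 2 - g.normSq x (g.hessian u x)
          - g.ricci x (g.sharp x (mvfderiv (𝓡 4) u x).toLinearMap)
              (g.sharp x (mvfderiv (𝓡 4) u x).toLinearMap))
      - 2 * (g.dalembertian u x * g.gradSq u x
          + 2 * g.hessian u x (g.sharp x (mvfderiv (𝓡 4) u x).toLinearMap)
              (g.sharp x (mvfderiv (𝓡 4) u x).toLinearMap))
      - 1 / 4 * g.weylNormSq x
      + (1 - t) * (2 - t) * (g.scalarCurvature x + 6 * g.dalembertian u x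
          - 6 * g.gradSq u x) ^ 2 / 6 := by
  have hE : finrank ℝ (EuclideanSpace ℝ (Fin 4)) = 4 := finrank_euclideanSpace_fin
  have hg : g.IsRiemannian := hs.isRiemannian_background
  have hu : ContMDiff (𝓡 4) 𝓘(ℝ) ∞ u := hs.contMDiff
  have hw : ContMDiff (𝓡 4) 𝓘(ℝ) ∞ (-u) := hu.neg
  have hgh : ∀ (y : M) (v v' : TangentSpace (𝓡 4) y),
      h.val y v v' = Real.exp (2 * (-u) y) * g.val y v v' := by
    intro y v v'
    rw [hs.val_eq y v v', Pi.neg_apply]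
    congr 1
    ring_nf
  -- the three conformal laws for `w = -u`
  have hσ := exp_mul_sigma2WeylSchouten_conformal_exp g h hg hw hgh x
  have hR : h.scalarCurvature x = (Real.exp (2 * (-u) x))⁻¹ * (g.scalarCurvature x
      - 6 * g.dalembertian (-u) x
      - 6 * g.innerDual x (mvfderiv (𝓡 4) (-u) x).toLinearMap (mvfderiv (𝓡 4) (-u) x).toLinearMap) :=
    g.scalarCurvature_conformal_exp_four h hE hw hgh x
  have hψ : ContMDiff (𝓡 4) 𝓘(ℝ) ∞ (fun y ↦ Real.exp ((-u) y)) :=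
    fun y ↦ Real.contDiff_exp.contDiffAt.comp_contMDiffAt (hw y)
  have hψpos : ∀ y, 0 < Real.exp ((-u) y) := fun y ↦ Real.exp_pos _
  have hgh' : ∀ (y : M) (v v' : TangentSpace (𝓡 4) y),
      h.val y v v' = Real.exp ((-u) y) ^ 2 * g.val y v v' := by
    intro y v v'
    rw [hgh y v v', sq, ← Real.exp_add]
    congr 1
    ring
  have h3 : 3 ≤ finrank ℝ (EuclideanSpace ℝ (Fin 4)) := by rw [hE]; norm_num
  have hW : h.weylNormSq x = (Real.exp ((-u) x) ^ 4)⁻¹ * g.weylNormSq x :=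
    weylNormSq_conformal_sq h3 g h hg hψ hψpos hgh' x
  have he4 : Real.exp (4 * (-u) x) * (Real.exp (2 * (-u) x))⁻¹ ^ 2 = 1 := by
    rw [← Real.exp_neg, ← Real.exp_nat_mul, ← Real.exp_add]
    convert Real.exp_zero using 2
    push_cast
    ring
  have he4' : Real.exp (4 * (-u) x) * (Real.exp ((-u) x) ^ 4)⁻¹ = 1 := by
    rw [← Real.exp_nat_mul, ← Real.exp_neg, ← Real.exp_add]
    convert Real.exp_zero using 2
    push_cast
    ring
  -- the path equation times `e^{4w}`
  have heq := hs.pathOperator_eq x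
  unfold pathOperator at heq
  have hlhs : Real.exp (4 * (-u) x) * (q x * Real.exp (8 * u x)) = q x * Real.exp (4 * u x) := by
    rw [Pi.neg_apply, mul_left_comm, ← Real.exp_add]
    congr 2
    ring
  set S := g.scalarCurvature x - 6 * g.dalembertian (-u) x
      - 6 * g.innerDual x (mvfderiv (𝓡 4) (-u) x).toLinearMap (mvfderiv (𝓡 4) (-u) x).toLinearMap
    with hS
  have key : q x * Real.exp (4 * u x) = Real.exp (4 * (-u) x) * h.sigma2WeylSchouten x
        - 1 / 4 * (Real.exp (4 * (-u) x) * (Real.exp ((-u) x) ^ 4)⁻¹) * g.weylNormSq x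
        + (1 - t) * (2 - t) * (Real.exp (4 * (-u) x) * (Real.exp (2 * (-u) x))⁻¹ ^ 2) * S ^ 2 / 6 := by
    rw [← hlhs, ← heq, hR, hW]
    ring
  rw [he4, he4', hσ] at key
  -- `w = -u`: all terms in terms of `u`
  have hH : g.hessian (-u) x = -g.hessian u x := g.hessian_neg u x
  have hd : mvfderiv (𝓡 4) (-u) x = -mvfderiv (𝓡 4) u x := mvfderiv_neg
  have hΔ : g.dalembertian (-u) x = -g.dalembertian u x := by
    unfold PseudoRiemannianMetric.dalembertian
    rw [hH, g.trace_neg x]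
  have hdl : (mvfderiv (𝓡 4) (-u) x).toLinearMap = -(mvfderiv (𝓡 4) u x).toLinearMap := by
    rw [hd, ContinuousLinearMap.toLinearMap_neg]
  have hgrad : g.innerDual x (mvfderiv (𝓡 4) (-u) x).toLinearMap (mvfderiv (𝓡 4) (-u) x).toLinearMap
      = g.gradSq u x := by
    rw [hdl, PseudoRiemannianMetric.gradSq, PseudoRiemannianMetric.innerDual,
      PseudoRiemannianMetric.innerDual]
    simp only [map_neg, LinearMap.neg_apply, neg_neg]
  have hgrad' : g.gradSq (-u) x = g.gradSq u x := by
    rw [PseudoRiemannianMetric.gradSq]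
    exact hgrad
  have hN : g.normSq x (g.hessian (-u) x) = g.normSq x (g.hessian u x) := by
    rw [hH, ← innerBilin_self, ← innerBilin_self, ← neg_one_smul ℝ (g.hessian u x),
      innerBilin_smul_left, innerBilin_smul_right]
    ring
  have hI : g.innerBilin x (g.ricci x) (g.hessian (-u) x) = -g.innerBilin x (g.ricci x) (g.hessian u x) := by
    rw [hH, ← neg_one_smul ℝ (g.hessian u x), innerBilin_smul_right]
    ring
  have hsh : g.sharp x (mvfderiv (𝓡 4) (-u) x).toLinearMap = -g.sharp x (mvfderiv (𝓡 4) u x).toLinearMap := by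
    rw [hdl, map_neg]
  rw [hS, hN, hI, hsh, hΔ, hgrad, hgrad', hH] at key
  simp only [map_neg, LinearMap.neg_apply, neg_neg] at key
  rw [key]
  ring

end Frame

/-! ### Frame algebra: the Hessian norm is controlled by the Laplacian -/

section Algebra

/-- AM–GM bookkeeping: `−2xy ≤ 4x² + y²/4`. [folklore] -/
private theorem neg_two_mul_le (x y : ℝ) : -(2 * (x * y)) ≤ 4 * x ^ 2 + y ^ 2 / 4 := by
  nlinarith [sq_nonneg (2 * x + y / 2)]

/-- AM–GM bookkeeping: `−2xy ≤ x² + y²`. [folklore] -/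
private theorem neg_two_mul_le' (x y : ℝ) : -(2 * (x * y)) ≤ x ^ 2 + y ^ 2 := by
  nlinarith [sq_nonneg (x + y)]

/-- AM–GM bookkeeping: `−4xy ≤ x²/4 + 16y²`. [folklore] -/
private theorem neg_four_mul_le (x y : ℝ) : -(4 * (x * y)) ≤ x ^ 2 / 4 + 16 * y ^ 2 := by
  nlinarith [sq_nonneg (x / 2 + 4 * y)]

/-- **The algebra of the reduction to a Laplacian bound** (Chen 2005, §3, first paragraph; here
for the Weyl-weighted `σ₂`-path in a frame). If symmetric `4 × 4` arrays `Rc`, `H`, a vector `d`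
and reals `σ, Wn ≥ 0, R, k ≥ 0, Q ≥ 0` satisfy the frame form of the path equation
(`IsPathSolution.frame_identity`), then
`Σ H_{ab}² ≤ (7/3 + 12k)(Σ_a H_{aa})² + (2/3)(|σ| + 5ΣRc² + (1+k)R²/2 + 18(1+k)(Σ d_a²)²)`. [cite: Chen2005, §3] -/
theorem sum_sq_le_of_frame_identity (Rc H : Fin 4 → Fin 4 → ℝ) (d : Fin 4 → ℝ)
    (σ Wn R k Q : ℝ) (hWn : 0 ≤ Wn) (hk : 0 ≤ k) (hQ : 0 ≤ Q)
    (hid : Q = σ - (2 * ∑ a, ∑ b, Rc a b * H a b - R * ∑ a, H a a)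
      + 2 * ((∑ a, H a a) ^ 2 - ∑ a, ∑ b, H a b ^ 2 - ∑ a, ∑ b, Rc a b * (d a * d b))
      - 2 * ((∑ a, H a a) * (∑ a, d a ^ 2) + 2 * ∑ a, ∑ b, H a b * (d a * d b))
      - 1 / 4 * Wn + k * (R + 6 * ∑ a, H a a - 6 * ∑ a, d a ^ 2) ^ 2 / 6) :
    ∑ a, ∑ b, H a b ^ 2 ≤ (7 / 3 + 12 * k) * (∑ a, H a a) ^ 2
      + 2 / 3 * (|σ| + 5 * ∑ a, ∑ b, Rc a b ^ 2 + (1 + k) * R ^ 2 / 2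
        + 18 * (1 + k) * (∑ a, d a ^ 2) ^ 2) := by
  set N := ∑ a, ∑ b, H a b ^ 2 with hN
  set T := ∑ a, H a a with hT
  set s := ∑ a, d a ^ 2 with hs
  set P := ∑ a, ∑ b, Rc a b ^ 2 with hP
  have hs0 : 0 ≤ s := Finset.sum_nonneg fun a _ ↦ sq_nonneg _
  -- `Σ_{ab} (d_a d_b)² = s²`
  have hdd : ∑ a, ∑ b, (d a * d b) ^ 2 = s ^ 2 := by
    rw [hs, sq, Finset.sum_mul_sum]
    refine Finset.sum_congr rfl fun a _ ↦ Finset.sum_congr rfl fun b _ ↦ ?_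
    ring
  -- the three AM–GM bounds, summed
  have h1 : -(2 * ∑ a, ∑ b, Rc a b * H a b) ≤ 4 * P + N / 4 := by
    have : -(2 * ∑ a, ∑ b, Rc a b * H a b) = ∑ a, ∑ b, -(2 * (Rc a b * H a b)) := by
      simp only [Finset.mul_sum, Finset.sum_neg_distrib]
    rw [this, hP, hN, Finset.mul_sum, Finset.sum_div, ← Finset.sum_add_distrib]
    refine Finset.sum_le_sum fun a _ ↦ ?_
    rw [Finset.mul_sum, Finset.sum_div, ← Finset.sum_add_distrib]
    exact Finset.sum_le_sum fun b _ ↦ neg_two_mul_le _ _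
  have h2 : -(2 * ∑ a, ∑ b, Rc a b * (d a * d b)) ≤ P + s ^ 2 := by
    have : -(2 * ∑ a, ∑ b, Rc a b * (d a * d b)) = ∑ a, ∑ b, -(2 * (Rc a b * (d a * d b))) := by
      simp only [Finset.mul_sum, Finset.sum_neg_distrib]
    rw [this, hP, ← hdd, ← Finset.sum_add_distrib]
    refine Finset.sum_le_sum fun a _ ↦ ?_
    rw [← Finset.sum_add_distrib]
    exact Finset.sum_le_sum fun b _ ↦ neg_two_mul_le' _ _
  have h3 : -(4 * ∑ a, ∑ b, H a b * (d a * d b)) ≤ N / 4 + 16 * s ^ 2 := by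
    have : -(4 * ∑ a, ∑ b, H a b * (d a * d b)) = ∑ a, ∑ b, -(4 * (H a b * (d a * d b))) := by
      simp only [Finset.mul_sum, Finset.sum_neg_distrib]
    rw [this, hN, ← hdd, Finset.sum_div, Finset.mul_sum, ← Finset.sum_add_distrib]
    refine Finset.sum_le_sum fun a _ ↦ ?_
    rw [Finset.sum_div, Finset.mul_sum, ← Finset.sum_add_distrib]
    exact Finset.sum_le_sum fun b _ ↦ neg_four_mul_le _ _
  -- the remaining elementary bounds
  have h4 : R * T ≤ (R ^ 2 + T ^ 2) / 2 := by nlinarith [sq_nonneg (R - T)]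
  have h5 : -(2 * (T * s)) ≤ T ^ 2 + s ^ 2 := neg_two_mul_le' T s
  have h6 : k * (R + 6 * T - 6 * s) ^ 2 / 6 ≤ k * (R ^ 2 + 36 * T ^ 2 + 36 * s ^ 2) / 2 := by
    have : (R + 6 * T - 6 * s) ^ 2 ≤ 3 * (R ^ 2 + 36 * T ^ 2 + 36 * s ^ 2) := by
      nlinarith [sq_nonneg (R - 6 * T), sq_nonneg (R + 6 * s), sq_nonneg (T + s)]
    nlinarith
  have h7 : σ ≤ |σ| := le_abs_self σ
  -- the identity solved for `2N`
  have h2N : 2 * N = -Q + σ - 2 * (∑ a, ∑ b, Rc a b * H a b) + R * T + 2 * T ^ 2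
      - 2 * (∑ a, ∑ b, Rc a b * (d a * d b)) - 2 * (T * s)
      - 4 * (∑ a, ∑ b, H a b * (d a * d b)) - 1 / 4 * Wn
      + k * (R + 6 * T - 6 * s) ^ 2 / 6 := by
    rw [hid]
    ring
  nlinarith [h1, h2, h3, h4, h5, h6, h7, h2N, hWn, hQ, hk, hs0, sq_nonneg s, sq_nonneg R]

end Algebra

/-! ### Intrinsic consequences -/

section Intrinsic

variable {M : Type*} [TopologicalSpace M] [ChartedSpace (EuclideanSpace ℝ (Fin 4)) M]
  [IsManifold (𝓡 4) ∞ M]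
  (g h : PseudoRiemannianMetric (𝓡 4) ∞ (EuclideanSpace ℝ (Fin 4)) (TangentSpace (𝓡 4) : M → Type _))
  [g.HasLeviCivita] [h.HasLeviCivita]

/-- **Admissibility read on the background: `R_g + 6Δ_g u − 6|du|²_g > 0`** for a path solution
`h = e^{−2u} g` (`R_h = e^{2u}(R_g + 6Δ_g u − 6|du|²_g) > 0`, Besse 1987, 1.159 (f)); in
Gursky–Viaclovsky's terms `σ₁(g⁻¹A^t_u) > 0`, and it is the lower bound
"`0 < tr_g W = Δu + (a + nb)|∇u|² + tr_g B` … the Laplacian `Δu` has lower bound" opening the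
proof of Chen 2005, Thm. 1 (§3). [cite: Chen2005, §3] [cite: GurskyViaclovsky2003, §2 Def. 1] -/
theorem IsPathSolution.scalarCurvature_add_pos {u : M → ℝ} {t : ℝ} {q : M → ℝ}
    (hs : IsPathSolution g h u t q) (x : M) :
    0 < g.scalarCurvature x + 6 * g.dalembertian u x - 6 * g.gradSq u x := by
  have hE : finrank ℝ (EuclideanSpace ℝ (Fin 4)) = 4 := finrank_euclideanSpace_fin
  have hu : ContMDiff (𝓡 4) 𝓘(ℝ) ∞ u := hs.contMDiff
  have hw : ContMDiff (𝓡 4) 𝓘(ℝ) ∞ (-u) := hu.neg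
  have hgh : ∀ (y : M) (v v' : TangentSpace (𝓡 4) y),
      h.val y v v' = Real.exp (2 * (-u) y) * g.val y v v' := by
    intro y v v'
    rw [hs.val_eq y v v', Pi.neg_apply]
    congr 1
    ring_nf
  have hpos := hs.scalarCurvature_pos x
  rw [g.scalarCurvature_conformal_exp_four h hE hw hgh x] at hpos
  have hΔ : g.dalembertian (-u) x = -g.dalembertian u x := by
    unfold PseudoRiemannianMetric.dalembertian
    rw [g.hessian_neg u x, g.trace_neg x]
  have hgrad : g.innerDual x (mvfderiv (𝓡 4) (-u) x).toLinearMap (mvfderiv (𝓡 4) (-u) x).toLinearMap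
      = g.gradSq u x := by
    rw [mvfderiv_neg, PseudoRiemannianMetric.gradSq, PseudoRiemannianMetric.innerDual,
      PseudoRiemannianMetric.innerDual]
    simp only [ContinuousLinearMap.toLinearMap_neg, map_neg, LinearMap.neg_apply, neg_neg]
  rw [hΔ, hgrad] at hpos
  have h1 := (mul_pos_iff_of_pos_left (inv_pos.2 (Real.exp_pos (2 * (-u) x)))).1 hpos
  linarith

/-- **The Hessian is controlled by the Laplacian along the path** (step 1 of the `C²` estimate,
Chen 2005, §3; Gursky–Viaclovsky 2003, Prop. 6): for a path solution `h = e^{−2u} g` at a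
parameter `t ≤ 1` with right-hand side `q`, at every point where `q ≥ 0`,
`|Hess_g u|²_g ≤ (7/3 + 12k)(Δ_g u)² + (2/3)(|σ₂(A_g)| + 5|Ric_g|²_g + (1+k)R_g²/2 + 18(1+k)(|du|²_g)²)`,
`k = (1−t)(2−t)` — the frame identity `IsPathSolution.frame_identity` (i.e.
`|A^t_u|² = σ₁(A^t_u)² − 2σ₂(A^t_u)` with `σ₂(A^t_u) ≥ 0`) and AM–GM
(`sum_sq_le_of_frame_identity`), read intrinsically (`normSq_eq_sum_sq`,
`trace_eq_sum_of_isOrthonormalFrame`, `innerDual_eq_sum_of_isOrthoᵢ`). [cite: Chen2005, §3]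
[cite: GurskyViaclovsky2003, Prop. 6] -/
theorem IsPathSolution.normSq_hessian_le {u : M → ℝ} {t : ℝ} {q : M → ℝ}
    (hs : IsPathSolution g h u t q) (ht : t ≤ 1) {x : M} (hq : 0 ≤ q x) :
    g.normSq x (g.hessian u x) ≤
      (7 / 3 + 12 * ((1 - t) * (2 - t))) * g.dalembertian u x ^ 2
      + 2 / 3 * (|g.sigma2WeylSchouten x| + 5 * g.normSq x (g.ricci x)
        + (1 + (1 - t) * (2 - t)) * g.scalarCurvature x ^ 2 / 2
        + 18 * (1 + (1 - t) * (2 - t)) * g.gradSq u x ^ 2) := by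
  classical
  have hE : finrank ℝ (EuclideanSpace ℝ (Fin 4)) = 4 := finrank_euclideanSpace_fin
  have hι : Fintype.card (Fin 4) = finrank ℝ (EuclideanSpace ℝ (Fin 4)) := by
    rw [Fintype.card_fin, hE]
  have hg : g.IsRiemannian := hs.isRiemannian_background
  obtain ⟨b, hb⟩ := g.exists_basis_isOrthonormalFrame (x := x) (fun v hv ↦ hg x v hv) hE
  have he : g.IsOrthonormalFrame x (b : Fin 4 → TangentSpace (𝓡 4) x) := hb
  have hid := IsPathSolution.frame_identity g h hs he
  have hO : (g.toBilinForm x).IsOrthoᵢ b := fun i j hij ↦ hb.2 i j hij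
  have hcne : ∀ i, g.val x (b i) (b i) ≠ 0 := fun i ↦ by
    rw [hb.1 i]
    exact one_ne_zero
  have hN : ∑ a, ∑ c, g.hessian u x (b a) (b c) ^ 2 = g.normSq x (g.hessian u x) := by
    rw [g.normSq_eq_sum_sq x b hO hcne, Finset.sum_comm]
    simp only [hb.1, mul_one, div_one]
  have hP : ∑ a, ∑ c, g.ricci x (b a) (b c) ^ 2 = g.normSq x (g.ricci x) := by
    rw [g.normSq_eq_sum_sq x b hO hcne, Finset.sum_comm]
    simp only [hb.1, mul_one, div_one]
  have hT : ∑ a, g.hessian u x (b a) (b a) = g.dalembertian u x := by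
    unfold PseudoRiemannianMetric.dalembertian
    rw [g.trace_eq_sum_of_isOrthonormalFrame b hb]
  have hsq : ∑ a, mvfderiv (𝓡 4) u x (b a) ^ 2 = g.gradSq u x := by
    rw [PseudoRiemannianMetric.gradSq, g.innerDual_eq_sum_of_isOrthoᵢ x b hO hcne]
    refine Finset.sum_congr rfl fun a _ ↦ ?_
    rw [hb.1 a, div_one, sq]
    rfl
  have hk : 0 ≤ (1 - t) * (2 - t) := mul_nonneg (by linarith) (by linarith)
  have hQ : 0 ≤ q x * Real.exp (4 * u x) := mul_nonneg hq (Real.exp_pos _).le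
  have key := sum_sq_le_of_frame_identity (fun a c ↦ g.ricci x (b a) (b c))
    (fun a c ↦ g.hessian u x (b a) (b c)) (fun a ↦ mvfderiv (𝓡 4) u x (b a))
    (g.sigma2WeylSchouten x) (g.weylNormSq x) (g.scalarCurvature x) ((1 - t) * (2 - t))
    (q x * Real.exp (4 * u x)) (g.weylNormSq_nonneg x) hk hQ hid
  rw [hN, hP, hT, hsq] at key
  exact key

end Intrinsic

/-! ### The reduction on a closed manifold -/

section Compact

variable {M : Type*} [TopologicalSpace M] [CompactSpace M] [ChartedSpace (EuclideanSpace ℝ (Fin 4)) M]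
  [IsManifold (𝓡 4) ∞ M]
  (g : PseudoRiemannianMetric (𝓡 4) ∞ (EuclideanSpace ℝ (Fin 4)) (TangentSpace (𝓡 4) : M → Type _))
  [g.HasLeviCivita]

/-- **Reduction of the Hessian estimate to a Laplacian estimate, on a closed four-manifold**
(Chen 2005, §3, first paragraph; the form in which Gursky–Viaclovsky 2003, Prop. 6 uses the local
estimates). Let `g` be a `C^∞` Riemannian metric on a compact `4`-manifold, `q ≥ 0`, `δ, C₁, C₃`
reals and `P` any side condition on solutions (e.g. the `C⁰` bound). If every smooth admissible
solution `h = e^{−2u} g` of the weighted path equation at a parameter `t ∈ [δ, 1]` satisfying `P`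
and `|du|²_g ≤ C₁` has `Δ_g u ≤ C₃` everywhere, then every such solution has
`|Hess_g u|²_g ≤ C₂` everywhere, for a constant `C₂` depending only on `g, δ, C₁, C₃`
(`IsPathSolution.normSq_hessian_le`, the lower bound `Δ_g u > |du|²_g − R_g/6` of
`IsPathSolution.scalarCurvature_add_pos`, and the maxima of `|σ₂(A_g)|, |Ric_g|², |R_g|` on the
compact manifold). [cite: Chen2005, §3] [cite: GurskyViaclovsky2003, Prop. 6] -/
theorem exists_normSq_hessian_le_of_dalembertian_le (hg : g.IsRiemannian) {q : M → ℝ}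
    (hq : ∀ x, 0 ≤ q x) (δ C₁ C₃ : ℝ) (P : ∀ (h : PseudoRiemannianMetric (𝓡 4) ∞
      (EuclideanSpace ℝ (Fin 4)) (TangentSpace (𝓡 4) : M → Type _)) [h.HasLeviCivita], (M → ℝ) → Prop)
    (hΔ : ∀ t : ℝ, δ ≤ t → t ≤ 1 →
      ∀ (h : PseudoRiemannianMetric (𝓡 4) ∞ (EuclideanSpace ℝ (Fin 4)) (TangentSpace (𝓡 4) : M → Type _))
        [h.HasLeviCivita] (u : M → ℝ), IsPathSolution g h u t q → P h u →
        (∀ x, g.gradSq u x ≤ C₁) → ∀ x, g.dalembertian u x ≤ C₃) :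
    ∃ C₂ : ℝ, ∀ t : ℝ, δ ≤ t → t ≤ 1 →
      ∀ (h : PseudoRiemannianMetric (𝓡 4) ∞ (EuclideanSpace ℝ (Fin 4)) (TangentSpace (𝓡 4) : M → Type _))
        [h.HasLeviCivita] (u : M → ℝ), IsPathSolution g h u t q → P h u →
        (∀ x, g.gradSq u x ≤ C₁) → ∀ x, g.normSq x (g.hessian u x) ≤ C₂ := by
  have hE : finrank ℝ (EuclideanSpace ℝ (Fin 4)) = 4 := finrank_euclideanSpace_fin
  -- uniform bounds for the background curvature quantities on the compact manifold
  obtain ⟨Bσ, hBσ⟩ := isCompact_univ.exists_bound_of_continuousOn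
    (g.continuous_sigma2WeylSchouten hg hE).continuousOn
  obtain ⟨BP, hBP⟩ := isCompact_univ.exists_bound_of_continuousOn
    (g.contMDiff_normSq_ricci').continuous.continuousOn
  obtain ⟨BR, hBR⟩ := isCompact_univ.exists_bound_of_continuousOn
    g.contMDiff_scalarCurvature.continuous.continuousOn
  set kb : ℝ := (1 - δ) * (2 - δ) with hkb
  set D : ℝ := max |C₃| (|C₁| + BR / 6) with hD
  refine ⟨(7 / 3 + 12 * |kb|) * D ^ 2 + 2 / 3 * (Bσ + 5 * BP + (1 + |kb|) * BR ^ 2 / 2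
    + 18 * (1 + |kb|) * C₁ ^ 2), fun t hδt ht1 h _ u hs hP hC₁ x ↦ ?_⟩
  have hle := IsPathSolution.normSq_hessian_le g h hs ht1 (hq x)
  have hlow := IsPathSolution.scalarCurvature_add_pos g h hs x
  have hup := hΔ t hδt ht1 h u hs hP hC₁ x
  -- `|k| ≤ |kb|`, `|Δu| ≤ D`, `0 ≤ gradSq ≤ C₁`
  have hk0 : 0 ≤ (1 - t) * (2 - t) := mul_nonneg (by linarith) (by linarith)
  have hkle : (1 - t) * (2 - t) ≤ |kb| := by
    refine le_trans ?_ (le_abs_self kb)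
    rw [hkb]
    nlinarith [mul_nonneg (sub_nonneg.2 hδt) (by linarith : (0 : ℝ) ≤ 3 - t - δ)]
  have hσx : |g.sigma2WeylSchouten x| ≤ Bσ := by simpa using hBσ x (mem_univ x)
  have hPx : g.normSq x (g.ricci x) ≤ BP := le_trans (le_abs_self _) (by simpa using hBP x (mem_univ x))
  have hRx : |g.scalarCurvature x| ≤ BR := by simpa using hBR x (mem_univ x)
  have hgrad0 : 0 ≤ g.gradSq u x := by
    rw [PseudoRiemannianMetric.gradSq, innerDual_eq_val_sharp_sharp]
    set v := g.sharp x (mvfderiv (𝓡 4) u x).toLinearMap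
    by_cases hv : v = 0
    · rw [hv]; simp
    · exact (hg x v hv).le
  have hgradC : g.gradSq u x ≤ C₁ := hC₁ x
  have hC₁0 : 0 ≤ C₁ := hgrad0.trans hgradC
  have hΔabs : |g.dalembertian u x| ≤ D := by
    rw [abs_le]
    constructor
    · have h1 : -(|C₁| + BR / 6) ≤ g.dalembertian u x := by
        have hR' : g.scalarCurvature x ≤ BR := (abs_le.1 hRx).2
        have : 0 ≤ |C₁| := abs_nonneg _
        nlinarith
      exact le_trans (neg_le_neg (le_max_right _ _)) h1
    · exact hup.trans ((le_abs_self _).trans (le_max_left _ _))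
  have hD0 : 0 ≤ D := le_trans (abs_nonneg _) (le_max_left _ _)
  have hΔsq : g.dalembertian u x ^ 2 ≤ D ^ 2 := by
    rw [← sq_abs (g.dalembertian u x)]
    exact pow_le_pow_left₀ (abs_nonneg _) hΔabs 2
  have hR2 : g.scalarCurvature x ^ 2 ≤ BR ^ 2 := by
    rw [← sq_abs (g.scalarCurvature x)]
    exact pow_le_pow_left₀ (abs_nonneg _) hRx 2
  have hgr2 : g.gradSq u x ^ 2 ≤ C₁ ^ 2 := pow_le_pow_left₀ hgrad0 hgradC 2
  have hkb0 : 0 ≤ |kb| := abs_nonneg _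
  have ha : (7 / 3 + 12 * ((1 - t) * (2 - t))) * g.dalembertian u x ^ 2 ≤
      (7 / 3 + 12 * |kb|) * D ^ 2 :=
    mul_le_mul (by linarith) hΔsq (sq_nonneg _) (by positivity)
  have hb : (1 + (1 - t) * (2 - t)) * g.scalarCurvature x ^ 2 ≤ (1 + |kb|) * BR ^ 2 :=
    mul_le_mul (by linarith) hR2 (sq_nonneg _) (by positivity)
  have hc : 18 * (1 + (1 - t) * (2 - t)) * g.gradSq u x ^ 2 ≤ 18 * (1 + |kb|) * C₁ ^ 2 :=
    mul_le_mul (by linarith) hgr2 (sq_nonneg _) (by positivity)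
  linarith [hle, ha, hb, hc, hσx, hPx]

end Compact

/-! ### The named fact, conditionally on the Laplacian bound -/

section Assembly

/-- **Gursky–Viaclovsky 2003, Prop. 6 (`C²` part, weighted path) from the Laplacian estimate.**
The named fact `gurskyViaclovsky_hessianEstimate_weighted_four` follows from step 2 of the
published proof alone — the uniform upper bound `Δ_g u ≤ C₃(M, g, q, δ, C₀, C₁)` for smooth
admissible solutions `h = e^{−2u} g` at `t ∈ [δ, 1]` with `|u| ≤ C₀`, `|du|²_g ≤ C₁` (Chen 2005,
§3: the maximum principle for `H = Δu + |∇u|²` with the once and twice differentiated equation,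
the concavity of `σ₂^{1/2}(A^t)` and the Ricci identities; Gursky–Viaclovsky 2003, proof of
Prop. 6) — by `exists_normSq_hessian_le_of_dalembertian_le`. The hypothesis `hΔ` is that
Laplacian estimate, verbatim in the binders of the named fact; it is NOT proved in this file.
[cite: GurskyViaclovsky2003, Prop. 6] [cite: Chen2005, Thm. 1 (a), Cor. 2 and §3] -/
theorem hessianEstimate_of_dalembertianEstimate
    (hΔ : ∀ (M : Type) [TopologicalSpace M] [T2Space M] [SecondCountableTopology M]
      [ChartedSpace (EuclideanSpace ℝ (Fin 4)) M] [IsManifold (𝓡 4) ∞ M] [CompactSpace M]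
      (g : PseudoRiemannianMetric (𝓡 4) ∞ (EuclideanSpace ℝ (Fin 4)) (TangentSpace (𝓡 4) : M → Type _))
      [g.HasLeviCivita], g.IsRiemannian →
      ∀ (q : M → ℝ) (δ C₀ C₁ : ℝ), ContMDiff (𝓡 4) 𝓘(ℝ) ∞ q → (∀ x, 0 < q x) → δ ≤ 1 →
      ∃ C₃ : ℝ, ∀ t : ℝ, δ ≤ t → t ≤ 1 →
        ∀ (h : PseudoRiemannianMetric (𝓡 4) ∞ (EuclideanSpace ℝ (Fin 4)) (TangentSpace (𝓡 4) : M → Type _))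
          [h.HasLeviCivita] (u : M → ℝ),
          IsPathSolution g h u t q → (∀ x, |u x| ≤ C₀) → (∀ x, g.gradSq u x ≤ C₁) →
          ∀ x, g.dalembertian u x ≤ C₃) :
    gurskyViaclovsky_hessianEstimate_weighted_four := by
  unfold gurskyViaclovsky_hessianEstimate_weighted_four
  intro M _ _ _ _ _ _ g _ hg q δ C₀ C₁ hq hq0 hδ
  obtain ⟨C₃, hC₃⟩ := hΔ M g hg q δ C₀ C₁ hq hq0 hδ
  obtain ⟨C₂, hC₂⟩ := exists_normSq_hessian_le_of_dalembertian_le g hg (fun x ↦ (hq0 x).le) δ C₁ C₃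
    (fun h _ u ↦ ∀ x, |u x| ≤ C₀)
    (fun t hδt ht1 h _ u hs hC₀ hC₁ ↦ hC₃ t hδt ht1 h u hs hC₀ hC₁)
  exact ⟨C₂, fun t hδt ht1 h _ u hs hC₀ hC₁ ↦ hC₂ t hδt ht1 h u hs hC₀ hC₁⟩

end Assembly


/-! ## Step 2: the Laplacian bound on a compact manifold (Chen 2005, §3, read in charts)

The maximum-principle computation of Chen 2005, §3 is carried out in coordinates in
`Literature/Geometry/Lorentzian/CoordSigma2LaplacianEstimate.lean` and packaged with its
constants on a compact coordinate set in `CoordSigma2PathLocalEstimate.lean`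
(`MetricCoord.IsMetricOn.exists_lapAt_le_at_isLocalMax`). Below, the path equation, the test
function `Δu + |∇u|²` and its maximum are read in the chart at a point (the components
`chartRep` of the pulled-back metric `chartPullback`, O'Neill 1983, Ch. 3, Prop. 3.59: a local
isometry preserves every metric object), the frame identity `IsPathSolution.frame_identity` is
turned into the coordinate equation `½(c (tr W)² − |W|²) = (1/16)|W_g|² + (q/4)e^{4u}` by the
polynomial identity `MetricCoord.sigma2Path_frame_algebra`, and compactness of `M` assembles the
local bounds into hypothesis `hΔ` of `hessianEstimate_of_dalembertianEstimate`. -/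

section Chart

variable {M : Type*} [TopologicalSpace M] [ChartedSpace (EuclideanSpace ℝ (Fin 4)) M]
  [IsManifold (𝓡 4) ∞ M]
  (g : PseudoRiemannianMetric (𝓡 4) ∞ (EuclideanSpace ℝ (Fin 4)) (TangentSpace (𝓡 4) : M → Type _))
  [g.HasLeviCivita]

omit [g.HasLeviCivita] in
/-- **The chart components of `g` are metric components** on the chart target (`C^∞`, symmetric,
nondegenerate: `OpensChart.isMetricOn_repr`). [cite: ONeill1983, Ch. 3, Prop. 3.59] -/
theorem isMetricOn_chartRep (p : M) :
    MetricCoord.IsMetricOn (chartRep (𝓡 4) (fun _ : ℝ ↦ g) p 0) (chartTarget (𝓡 4) p : Set (EuclideanSpace ℝ (Fin 4))) :=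
  OpensChart.isMetricOn_repr (val_chartPullback_eq_chartRep (fun _ : ℝ ↦ g) p 0)

omit [g.HasLeviCivita] in
/-- The chart components of a Riemannian `g` are positive definite on the chart target.
[cite: ONeill1983, Ch. 3, Prop. 3.59] -/
theorem chartRep_pos (hg : g.IsRiemannian) (p : M) {y : EuclideanSpace ℝ (Fin 4)}
    (hy : y ∈ (chartTarget (𝓡 4) p : Set (EuclideanSpace ℝ (Fin 4))))
    (v : EuclideanSpace ℝ (Fin 4)) (hv : v ≠ 0) : 0 < (chartRep (𝓡 4) (fun _ : ℝ ↦ g) p 0) y v v := by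
  have h := chartRep_apply (fun _ : ℝ ↦ g) p 0 ⟨y, hy⟩ v v
  rw [h]
  exact chartPullback_pos g p ⟨y, hy⟩ (fun w hw ↦ hg _ w hw) v hv

omit [g.HasLeviCivita] in
/-- **`Ĝ(y)(v,w) = g(Φ y)(dΦ v, dΦ w)`** for the chart components (`Φ = chartInv`).
[cite: ONeill1983, Ch. 3, Prop. 3.59] -/
theorem chartRep_apply_eq (p : M) (y : chartTarget (𝓡 4) p) (v w : EuclideanSpace ℝ (Fin 4)) :
    (chartRep (𝓡 4) (fun _ : ℝ ↦ g) p 0) y v w = g.val (chartInv (𝓡 4) p y)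
      (mfderiv 𝓘(ℝ, EuclideanSpace ℝ (Fin 4)) (𝓡 4) (chartInv (𝓡 4) p) y v)
      (mfderiv 𝓘(ℝ, EuclideanSpace ℝ (Fin 4)) (𝓡 4) (chartInv (𝓡 4) p) y w) := by
  rw [chartRep_apply (fun _ : ℝ ↦ g) p 0 y v w]
  exact val_chartPullback_apply g p y v w

omit [g.HasLeviCivita] in
/-- A smooth function read in the chart is `C^∞` on the chart target. [folklore] -/
theorem contDiffOn_comp_extChartAt_symm {u : M → ℝ} (hu : ContMDiff (𝓡 4) 𝓘(ℝ) ∞ u) (p : M) :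
    ContDiffOn ℝ ∞ (u ∘ (extChartAt (𝓡 4) p).symm)
      (chartTarget (𝓡 4) p : Set (EuclideanSpace ℝ (Fin 4))) := by
  have h : ContMDiffOn 𝓘(ℝ, EuclideanSpace ℝ (Fin 4)) 𝓘(ℝ) ∞ (u ∘ (extChartAt (𝓡 4) p).symm)
      (extChartAt (𝓡 4) p).target :=
    hu.comp_contMDiffOn (contMDiffOn_extChartAt_symm p)
  exact contMDiffOn_iff_contDiffOn.1 h

/-- **`Δ` read in the chart**: `lapAt Ĝ (u ∘ φ⁻¹) y = Δ_g u (Φ y)`. [cite: ONeill1983, Ch. 3, Prop. 3.59] -/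
theorem lapAt_chart {u : M → ℝ} (hu : ContMDiff (𝓡 4) 𝓘(ℝ) ∞ u) (p : M) (y : chartTarget (𝓡 4) p) :
    MetricCoord.lapAt (chartRep (𝓡 4) (fun _ : ℝ ↦ g) p 0) (u ∘ (extChartAt (𝓡 4) p).symm) y =
      g.dalembertian u (chartInv (𝓡 4) p y) := by
  haveI := (chartPullback (𝓡 4) g p).hasLeviCivita
  have hG := val_chartPullback_eq_chartRep (fun _ : ℝ ↦ g) p 0
  have hrep : ∀ z : chartTarget (𝓡 4) p, (u ∘ chartInv (𝓡 4) p) z = (u ∘ (extChartAt (𝓡 4) p).symm) z :=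
    fun z ↦ rfl
  have hFc : ContDiffAt ℝ 2 (u ∘ (extChartAt (𝓡 4) p).symm) y :=
    (((contDiffOn_comp_extChartAt_symm hu p) y y.2).contDiffAt
      ((isOpen_extChartAt_target p).mem_nhds y.2)).of_le (by norm_cast)
  rw [← Lorentzian.OpensChart.dalembertian_eq_lapAt hG y hrep hFc,
    g.dalembertian_comap contMDiff_pullbackBilin_holds (contMDiff_chartInv p)
      (injective_mfderiv_chartInv p) rfl ((hu _).of_le (by norm_cast))]


/-- `|∇f|²` of a metric on an open subset of the model space is `gradSqAt` of its components
(local copy of `OpensChart.gradSq_eq_gradSqAt` of `PerelmanEntropyFormulaManifold.lean`, kept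
here to avoid that file's imports). [cite: ONeill1983, Ch. 3, p. 85] -/
private theorem gradSq_eq_gradSqAt_aux {U : TopologicalSpace.Opens (EuclideanSpace ℝ (Fin 4))}
    {g' : PseudoRiemannianMetric 𝓘(ℝ, EuclideanSpace ℝ (Fin 4)) ∞ (EuclideanSpace ℝ (Fin 4))
      (TangentSpace 𝓘(ℝ, EuclideanSpace ℝ (Fin 4)) : U → Type _)}
    {G : EuclideanSpace ℝ (Fin 4) → EuclideanSpace ℝ (Fin 4) →L[ℝ] EuclideanSpace ℝ (Fin 4) →L[ℝ] ℝ}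
    (hG : ∀ y : U, g'.val y = G y) (x : U) {f : U → ℝ} {F : EuclideanSpace ℝ (Fin 4) → ℝ}
    (hf : ∀ y : U, f y = F y) (hF : DifferentiableAt ℝ F x) :
    g'.gradSq f x = MetricCoord.gradSqAt G F x := by
  have hd : (mvfderiv 𝓘(ℝ, EuclideanSpace ℝ (Fin 4)) f x :
      TangentSpace 𝓘(ℝ, EuclideanSpace ℝ (Fin 4)) x →L[ℝ] ℝ) = fderiv ℝ F x := by
    ext v
    exact OpensChart.mvfderiv_eq x f F hf hF v
  rw [PseudoRiemannianMetric.gradSq_eq, hd, OpensChart.sharp_eq_sharpAt hG x,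
    MetricCoord.gradSqAt_apply]
  rfl

omit [g.HasLeviCivita] in
/-- **`|∇u|²` read in the chart**: `gradSqAt Ĝ (u ∘ φ⁻¹) y = |∇u|²_g (Φ y)`.
[cite: ONeill1983, Ch. 3, Prop. 3.59] -/
theorem gradSqAt_chart {u : M → ℝ} (hu : ContMDiff (𝓡 4) 𝓘(ℝ) ∞ u) (p : M) (y : chartTarget (𝓡 4) p) :
    MetricCoord.gradSqAt (chartRep (𝓡 4) (fun _ : ℝ ↦ g) p 0) (u ∘ (extChartAt (𝓡 4) p).symm) y =
      g.gradSq u (chartInv (𝓡 4) p y) := by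
  have hG := val_chartPullback_eq_chartRep (fun _ : ℝ ↦ g) p 0
  have hrep : ∀ z : chartTarget (𝓡 4) p, (u ∘ chartInv (𝓡 4) p) z = (u ∘ (extChartAt (𝓡 4) p).symm) z :=
    fun z ↦ rfl
  have hFc : DifferentiableAt ℝ (u ∘ (extChartAt (𝓡 4) p).symm) y :=
    (((contDiffOn_comp_extChartAt_symm hu p) y y.2).contDiffAt
      ((isOpen_extChartAt_target p).mem_nhds y.2)).differentiableAt (by simp)
  have hF : MDifferentiableAt (𝓡 4) 𝓘(ℝ, ℝ) u (chartInv (𝓡 4) p y) :=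
    (hu _).mdifferentiableAt (by simp)
  rw [← gradSq_eq_gradSqAt_aux hG y hrep hFc]
  unfold PseudoRiemannianMetric.gradSq
  exact g.innerDual_mvfderiv_comp contMDiff_pullbackBilin_holds (contMDiff_chartInv p)
    (injective_mfderiv_chartInv p) rfl y hF hF

/-- **`R` read in the chart**: `scalAt Ĝ y = R_g(Φ y)`. [cite: ONeill1983, Ch. 3, Prop. 3.59] -/
theorem scalAt_chart (p : M) (y : chartTarget (𝓡 4) p) :
    MetricCoord.scalAt (chartRep (𝓡 4) (fun _ : ℝ ↦ g) p 0) y = g.scalarCurvature (chartInv (𝓡 4) p y) := by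
  haveI := (chartPullback (𝓡 4) g p).hasLeviCivita
  have hG := val_chartPullback_eq_chartRep (fun _ : ℝ ↦ g) p 0
  rw [← Lorentzian.OpensChart.scalarCurvature_eq_scalAt hG y,
    g.scalarCurvature_comap contMDiff_pullbackBilin_holds (contMDiff_chartInv p)
      (injective_mfderiv_chartInv p) rfl]

/-- **`Ric` read in the chart**: `ricAt Ĝ y v w = Ric_g(Φ y)(dΦ v, dΦ w)`.
[cite: ONeill1983, Ch. 3, Prop. 3.59] -/
theorem ricAt_chart (p : M) (y : chartTarget (𝓡 4) p) (v w : EuclideanSpace ℝ (Fin 4)) :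
    MetricCoord.ricAt (chartRep (𝓡 4) (fun _ : ℝ ↦ g) p 0) y v w = g.ricci (chartInv (𝓡 4) p y)
      (mfderiv 𝓘(ℝ, EuclideanSpace ℝ (Fin 4)) (𝓡 4) (chartInv (𝓡 4) p) y v)
      (mfderiv 𝓘(ℝ, EuclideanSpace ℝ (Fin 4)) (𝓡 4) (chartInv (𝓡 4) p) y w) := by
  haveI := (chartPullback (𝓡 4) g p).hasLeviCivita
  have hG := val_chartPullback_eq_chartRep (fun _ : ℝ ↦ g) p 0
  rw [← Lorentzian.OpensChart.ricci_eq_ricAt hG y,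
    g.ricci_comap_apply contMDiff_pullbackBilin_holds (contMDiff_chartInv p)
      (injective_mfderiv_chartInv p) rfl]

/-- **`Hess u` read in the chart**: `hessAt Ĝ (u ∘ φ⁻¹) y v w = Hess_g u(Φ y)(dΦ v, dΦ w)`.
[cite: ONeill1983, Ch. 3, Prop. 3.59] -/
theorem hessAt_chart {u : M → ℝ} (hu : ContMDiff (𝓡 4) 𝓘(ℝ) ∞ u) (p : M) (y : chartTarget (𝓡 4) p)
    (v w : EuclideanSpace ℝ (Fin 4)) :
    MetricCoord.hessAt (chartRep (𝓡 4) (fun _ : ℝ ↦ g) p 0) (u ∘ (extChartAt (𝓡 4) p).symm) y v w =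
      g.hessian u (chartInv (𝓡 4) p y)
        (mfderiv 𝓘(ℝ, EuclideanSpace ℝ (Fin 4)) (𝓡 4) (chartInv (𝓡 4) p) y v)
        (mfderiv 𝓘(ℝ, EuclideanSpace ℝ (Fin 4)) (𝓡 4) (chartInv (𝓡 4) p) y w) := by
  haveI := (chartPullback (𝓡 4) g p).hasLeviCivita
  have hG := val_chartPullback_eq_chartRep (fun _ : ℝ ↦ g) p 0
  have hrep : ∀ z : chartTarget (𝓡 4) p, (u ∘ chartInv (𝓡 4) p) z = (u ∘ (extChartAt (𝓡 4) p).symm) z :=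
    fun z ↦ rfl
  have hFc : ContDiffAt ℝ 2 (u ∘ (extChartAt (𝓡 4) p).symm) y :=
    (((contDiffOn_comp_extChartAt_symm hu p) y y.2).contDiffAt
      ((isOpen_extChartAt_target p).mem_nhds y.2)).of_le (by norm_cast)
  rw [← Lorentzian.OpensChart.hessian_eq_hessAt hG y hrep hFc,
    g.hessian_comap_apply contMDiff_pullbackBilin_holds (contMDiff_chartInv p)
      (injective_mfderiv_chartInv p) rfl ((hu _).of_le (by norm_cast))]

/-- **`du` read in the chart**: `D(u ∘ φ⁻¹)(y) v = du_{Φ y}(dΦ v)`. [folklore] -/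
theorem fderiv_chart {u : M → ℝ} (hu : ContMDiff (𝓡 4) 𝓘(ℝ) ∞ u) (p : M) (y : chartTarget (𝓡 4) p)
    (v : EuclideanSpace ℝ (Fin 4)) :
    fderiv ℝ (u ∘ (extChartAt (𝓡 4) p).symm) y v =
      mvfderiv (𝓡 4) u (chartInv (𝓡 4) p y)
        (mfderiv 𝓘(ℝ, EuclideanSpace ℝ (Fin 4)) (𝓡 4) (chartInv (𝓡 4) p) y v) := by
  have hrep : ∀ z : chartTarget (𝓡 4) p, (u ∘ chartInv (𝓡 4) p) z = (u ∘ (extChartAt (𝓡 4) p).symm) z :=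
    fun z ↦ rfl
  have hFc : DifferentiableAt ℝ (u ∘ (extChartAt (𝓡 4) p).symm) y :=
    (((contDiffOn_comp_extChartAt_symm hu p) y y.2).contDiffAt
      ((isOpen_extChartAt_target p).mem_nhds y.2)).differentiableAt (by simp)
  have hF : MDifferentiableAt (𝓡 4) 𝓘(ℝ, ℝ) u (chartInv (𝓡 4) p y) :=
    (hu _).mdifferentiableAt (by simp)
  have hΦ : MDifferentiableAt 𝓘(ℝ, EuclideanSpace ℝ (Fin 4)) (𝓡 4) (chartInv (𝓡 4) p) y :=
    ((contMDiff_chartInv p).of_le le_self_add y).mdifferentiableAt (by simp)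
  rw [← OpensChart.mvfderiv_eq y (u ∘ chartInv (𝓡 4) p) (u ∘ (extChartAt (𝓡 4) p).symm) hrep hFc v,
    PseudoRiemannianMetric.mvfderiv_comp_apply hF hΦ v]

end Chart

section ChartEquation

variable {M : Type*} [TopologicalSpace M] [ChartedSpace (EuclideanSpace ℝ (Fin 4)) M]
  [IsManifold (𝓡 4) ∞ M]
  (g h : PseudoRiemannianMetric (𝓡 4) ∞ (EuclideanSpace ℝ (Fin 4)) (TangentSpace (𝓡 4) : M → Type _))
  [g.HasLeviCivita] [h.HasLeviCivita]

omit [g.HasLeviCivita] [h.HasLeviCivita] in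
/-- The background field `B = ½(Ric − (R/6)G)` of the chart components is symmetric on the chart
target. [cite: ONeill1983, Ch. 3, Lemma 3.52] -/
theorem chartRep_background_symm (p : M) {y : EuclideanSpace ℝ (Fin 4)}
    (hy : y ∈ (chartTarget (𝓡 4) p : Set (EuclideanSpace ℝ (Fin 4)))) (v w : EuclideanSpace ℝ (Fin 4)) :
    ((1 / 2 : ℝ) • (MetricCoord.ricAt (chartRep (𝓡 4) (fun _ : ℝ ↦ g) p 0) y - (MetricCoord.scalAt (chartRep (𝓡 4) (fun _ : ℝ ↦ g) p 0) y / 6) • (chartRep (𝓡 4) (fun _ : ℝ ↦ g) p 0) y)) v w =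
    ((1 / 2 : ℝ) • (MetricCoord.ricAt (chartRep (𝓡 4) (fun _ : ℝ ↦ g) p 0) y - (MetricCoord.scalAt (chartRep (𝓡 4) (fun _ : ℝ ↦ g) p 0) y / 6) • (chartRep (𝓡 4) (fun _ : ℝ ↦ g) p 0) y)) w v := by
  have hG := isMetricOn_chartRep g p
  simp only [FunLike.coe_smul, Pi.smul_apply, _root_.sub_apply, smul_eq_mul]
  rw [hG.ricAt_comm hy v w, hG.symm y hy v w]

set_option maxHeartbeats 4000000 in
/-- **The weighted path equation read in a chart** (Gursky–Viaclovsky 2003, §1: for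
`h = e^{−2u}g`, `A^t_h = A^t_g + ∇²u + ((1−t)/2)(Δu)g + du⊗du − ((2−t)/2)|∇u|²g`, so that
(path) `P_t(h) = q e^{8u}` is `σ₂^{1/2}(g⁻¹A^t_u) = f(x)e^{2u}`; here with the Weyl weight and in
the un-rooted normalisation): for a path solution and the components `Ĝ` of `g` in the chart at `p`,
the field `W = Hess û + dû⊗dû − ½|∇û|²Ĝ + ½(Ric_Ĝ − (R_Ĝ/6)Ĝ)` of `û = u ∘ φ⁻¹` satisfies
`½(c_t (tr_Ĝ W)² − |W|²_Ĝ) = (1/16)|W_g|²(φ⁻¹y) + (q(φ⁻¹y)/4) e^{4û(y)}`, `c_t = 1 + 3(1−t)(2−t)`, at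
every point of the chart target. Proof: a `Ĝ(y)`-orthonormal basis of the model space is pushed to a
`g`-orthonormal frame by `dφ⁻¹` (`chartRep_apply_eq`), in which `IsPathSolution.frame_identity`
holds; its components are the chart components (`hessAt_chart`, `ricAt_chart`, `fderiv_chart`,
`scalAt_chart`, `sigma2WeylSchouten_eq_sigma2WeylSchoutenFrame`), and the scalar identity is
`MetricCoord.sigma2Path_frame_algebra`. [cite: GurskyViaclovsky2003, §1 (PDE), §3 (path)]
[cite: Chen2005, §2.1 (the equation for `A_{g_u}`)] -/
theorem IsPathSolution.chart_equation {u : M → ℝ} {t : ℝ} {q : M → ℝ}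
    (hs : IsPathSolution g h u t q) (p : M) (y : chartTarget (𝓡 4) p)
    (W : EuclideanSpace ℝ (Fin 4) → EuclideanSpace ℝ (Fin 4) →L[ℝ] EuclideanSpace ℝ (Fin 4) →L[ℝ] ℝ)
    (hW : W = (fun z ↦ MetricCoord.hessAt (chartRep (𝓡 4) (fun _ : ℝ ↦ g) p 0) (u ∘ (extChartAt (𝓡 4) p).symm) z
        + ContinuousLinearMap.smulRightL ℝ (EuclideanSpace ℝ (Fin 4)) (EuclideanSpace ℝ (Fin 4) →L[ℝ] ℝ)
            (fderiv ℝ (u ∘ (extChartAt (𝓡 4) p).symm) z) (fderiv ℝ (u ∘ (extChartAt (𝓡 4) p).symm) z)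
        - (1 / 2 : ℝ) • (MetricCoord.gradSqAt (chartRep (𝓡 4) (fun _ : ℝ ↦ g) p 0) (u ∘ (extChartAt (𝓡 4) p).symm) z • (chartRep (𝓡 4) (fun _ : ℝ ↦ g) p 0) z)
        + (1 / 2 : ℝ) • (MetricCoord.ricAt (chartRep (𝓡 4) (fun _ : ℝ ↦ g) p 0) z - (MetricCoord.scalAt (chartRep (𝓡 4) (fun _ : ℝ ↦ g) p 0) z / 6) • (chartRep (𝓡 4) (fun _ : ℝ ↦ g) p 0) z))) :
    1 / 2 * ((1 + 3 * ((1 - t) * (2 - t))) * MetricCoord.mtrAt (chartRep (𝓡 4) (fun _ : ℝ ↦ g) p 0) y (W y) ^ 2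
      - MetricCoord.pairAt (chartRep (𝓡 4) (fun _ : ℝ ↦ g) p 0) y (W y) (W y)) =
      1 / 16 * g.weylNormSq ((extChartAt (𝓡 4) p).symm y) + 1 / 4 * (q ((extChartAt (𝓡 4) p).symm y) * Real.exp (4 * (u ∘ (extChartAt (𝓡 4) p).symm) y)) := by
  classical
  have hG := isMetricOn_chartRep g p
  have hy : (y : EuclideanSpace ℝ (Fin 4)) ∈ (chartTarget (𝓡 4) p : Set (EuclideanSpace ℝ (Fin 4))) := y.2
  have hi : ((chartRep (𝓡 4) (fun _ : ℝ ↦ g) p 0) y).IsInvertible := hG.isInvertible y hy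
  have hsy : ∀ v w, (chartRep (𝓡 4) (fun _ : ℝ ↦ g) p 0) y v w = (chartRep (𝓡 4) (fun _ : ℝ ↦ g) p 0) y w v := hG.symm y hy
  have hgR : g.IsRiemannian := hs.isRiemannian_background
  have hu : ContMDiff (𝓡 4) 𝓘(ℝ) ∞ u := hs.contMDiff
  have hposy : ∀ v, v ≠ 0 → 0 < (chartRep (𝓡 4) (fun _ : ℝ ↦ g) p 0) y v v := chartRep_pos g hgR p hy
  have hf : ContDiffOn ℝ ∞ (u ∘ (extChartAt (𝓡 4) p).symm) (chartTarget (𝓡 4) p : Set (EuclideanSpace ℝ (Fin 4))) :=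
    contDiffOn_comp_extChartAt_symm hu p
  -- a `Ĝ(y)`-orthonormal basis of the model space, indexed by `Fin 4`
  obtain ⟨e₀, he₀⟩ := MetricCoord.exists_orthonormal_basis hsy hposy
  have hE : finrank ℝ (EuclideanSpace ℝ (Fin 4)) = 4 := finrank_euclideanSpace_fin
  set ê : Module.Basis (Fin 4) ℝ (EuclideanSpace ℝ (Fin 4)) := e₀.reindex (finCongr hE) with hê
  have hê' : ∀ i j, (chartRep (𝓡 4) (fun _ : ℝ ↦ g) p 0) y (ê i) (ê j) = if i = j then 1 else 0 := by
    intro i j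
    rw [hê, Module.Basis.reindex_apply, Module.Basis.reindex_apply, he₀]
    simp only [finCongr_symm, EmbeddingLike.apply_eq_iff_eq]
  -- the pushed-forward frame on `M` is `g`-orthonormal
  have heM : g.IsOrthonormalFrame (chartInv (𝓡 4) p y) (fun a ↦ (mfderiv 𝓘(ℝ, EuclideanSpace ℝ (Fin 4)) (𝓡 4) (chartInv (𝓡 4) p) y (ê a))) := by
    refine ⟨fun i ↦ ?_, fun i j hij ↦ ?_⟩
    · have h1 := chartRep_apply_eq g p y (ê i) (ê i)
      rw [hê' i i, if_pos rfl] at h1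
      exact h1.symm
    · have h1 := chartRep_apply_eq g p y (ê i) (ê j)
      rw [hê' i j, if_neg hij] at h1
      exact h1.symm
  -- the frame identity at `Φ y`, with `σ₂(A)` in the frame and all components read in the chart
  have key := IsPathSolution.frame_identity g h hs heM
  rw [g.sigma2WeylSchouten_eq_sigma2WeylSchoutenFrame (WithTop.coe_le_coe.mpr le_top) hE heM,
    g.sigma2WeylSchoutenFrame_eq_of_isOrthonormalFrame (WithTop.coe_le_coe.mpr le_top) hE heM] at key
  simp only [PseudoRiemannianMetric.tracelessRicciNormSqFrame, PseudoRiemannianMetric.tracelessRicciFrame,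
    frameDelta, Fintype.card_fin, Nat.cast_ofNat] at key
  simp only [← hessAt_chart g hu p y, ← ricAt_chart g p y, ← fderiv_chart hu p y,
    ← scalAt_chart g p y] at key
  have hux : u (chartInv (𝓡 4) p y) = (u ∘ (extChartAt (𝓡 4) p).symm) y := rfl
  rw [hux] at key
  -- the trace condition `Σ Ric_aa = R` in the chart
  have hS : ∑ a, MetricCoord.ricAt (chartRep (𝓡 4) (fun _ : ℝ ↦ g) p 0) y (ê a) (ê a) = MetricCoord.scalAt (chartRep (𝓡 4) (fun _ : ℝ ↦ g) p 0) y := by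
    have h1 := heM.sum_ricci_eq_scalarCurvature g hE
    simp only [← ricAt_chart g p y, ← scalAt_chart g p y] at h1
    exact h1
  -- the chart side in the frame
  have hBs : ∀ z ∈ (chartTarget (𝓡 4) p : Set (EuclideanSpace ℝ (Fin 4))), ∀ v w,
      ((1 / 2 : ℝ) • (MetricCoord.ricAt (chartRep (𝓡 4) (fun _ : ℝ ↦ g) p 0) z - (MetricCoord.scalAt (chartRep (𝓡 4) (fun _ : ℝ ↦ g) p 0) z / 6) • (chartRep (𝓡 4) (fun _ : ℝ ↦ g) p 0) z)) v w =
      ((1 / 2 : ℝ) • (MetricCoord.ricAt (chartRep (𝓡 4) (fun _ : ℝ ↦ g) p 0) z - (MetricCoord.scalAt (chartRep (𝓡 4) (fun _ : ℝ ↦ g) p 0) z / 6) • (chartRep (𝓡 4) (fun _ : ℝ ↦ g) p 0) z)) w v :=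
    fun z hz ↦ chartRep_background_symm g p hz
  have hWs : ∀ v w, W y v w = W y w v := hG.schouten_symm hf hBs hW hy
  rw [MetricCoord.pairAt_self_of_symm _ _ hWs, MetricCoord.mtrAt_eq_sum_frame ê hê' hi (W y),
    MetricCoord.normSqAt_eq_sum_frame ê hê' hi hsy (W y)]
  have hWab : ∀ a b, W y (ê a) (ê b) =
      MetricCoord.hessAt (chartRep (𝓡 4) (fun _ : ℝ ↦ g) p 0) (u ∘ (extChartAt (𝓡 4) p).symm) y (ê a) (ê b)
      + fderiv ℝ (u ∘ (extChartAt (𝓡 4) p).symm) y (ê a) * fderiv ℝ (u ∘ (extChartAt (𝓡 4) p).symm) y (ê b)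
      - 1 / 2 * (∑ c, fderiv ℝ (u ∘ (extChartAt (𝓡 4) p).symm) y (ê c) ^ 2) * (if a = b then 1 else 0)
      + 1 / 2 * (MetricCoord.ricAt (chartRep (𝓡 4) (fun _ : ℝ ↦ g) p 0) y (ê a) (ê b)
        - MetricCoord.scalAt (chartRep (𝓡 4) (fun _ : ℝ ↦ g) p 0) y / 6 * (if a = b then 1 else 0)) := by
    intro a b
    rw [hW]
    simp only [_root_.add_apply, _root_.sub_apply, FunLike.coe_smul, Pi.smul_apply, smul_eq_mul,
      MetricCoord.smulRightL_fderiv_apply, hê' a b, MetricCoord.gradSqAt_eq_sum_frame ê hê' hi hsy]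
    ring
  simp only [hWab]
  rw [← chartInv_apply]
  have halg := MetricCoord.sigma2Path_frame_algebra
    (fun a b ↦ MetricCoord.hessAt (chartRep (𝓡 4) (fun _ : ℝ ↦ g) p 0) (u ∘ (extChartAt (𝓡 4) p).symm) y (ê a) (ê b))
    (fun a b ↦ MetricCoord.ricAt (chartRep (𝓡 4) (fun _ : ℝ ↦ g) p 0) y (ê a) (ê b))
    (fun a ↦ fderiv ℝ (u ∘ (extChartAt (𝓡 4) p).symm) y (ê a)) (MetricCoord.scalAt (chartRep (𝓡 4) (fun _ : ℝ ↦ g) p 0) y)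
    (g.weylNormSq (chartInv (𝓡 4) p y)) t (q (chartInv (𝓡 4) p y) * Real.exp (4 * (u ∘ (extChartAt (𝓡 4) p).symm) y)) hS key
  simp only [if_true, mul_one] at halg ⊢
  linear_combination halg

/-- **`tr_Ĝ W = (R_g + 6Δ_g u − 6|∇u|²_g)/6 ∘ φ⁻¹ > 0`** for the chart field `W` of a path solution
(`mtrAt_schouten`, the chart dictionary, and `IsPathSolution.scalarCurvature_add_pos`: the conformal
metric has positive scalar curvature). [cite: GurskyViaclovsky2003, §3 (`A^t_{u_t} ∈ Γ₂⁺`)] -/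
theorem IsPathSolution.mtrAt_chart_pos {u : M → ℝ} {t : ℝ} {q : M → ℝ}
    (hs : IsPathSolution g h u t q) (p : M) (y : chartTarget (𝓡 4) p)
    (W : EuclideanSpace ℝ (Fin 4) → EuclideanSpace ℝ (Fin 4) →L[ℝ] EuclideanSpace ℝ (Fin 4) →L[ℝ] ℝ)
    (hW : W = (fun z ↦ MetricCoord.hessAt (chartRep (𝓡 4) (fun _ : ℝ ↦ g) p 0) (u ∘ (extChartAt (𝓡 4) p).symm) z
        + ContinuousLinearMap.smulRightL ℝ (EuclideanSpace ℝ (Fin 4)) (EuclideanSpace ℝ (Fin 4) →L[ℝ] ℝ)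
            (fderiv ℝ (u ∘ (extChartAt (𝓡 4) p).symm) z) (fderiv ℝ (u ∘ (extChartAt (𝓡 4) p).symm) z)
        - (1 / 2 : ℝ) • (MetricCoord.gradSqAt (chartRep (𝓡 4) (fun _ : ℝ ↦ g) p 0) (u ∘ (extChartAt (𝓡 4) p).symm) z • (chartRep (𝓡 4) (fun _ : ℝ ↦ g) p 0) z)
        + (1 / 2 : ℝ) • (MetricCoord.ricAt (chartRep (𝓡 4) (fun _ : ℝ ↦ g) p 0) z - (MetricCoord.scalAt (chartRep (𝓡 4) (fun _ : ℝ ↦ g) p 0) z / 6) • (chartRep (𝓡 4) (fun _ : ℝ ↦ g) p 0) z))) :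
    0 < MetricCoord.mtrAt (chartRep (𝓡 4) (fun _ : ℝ ↦ g) p 0) y (W y) := by
  have hG := isMetricOn_chartRep g p
  have hy : (y : EuclideanSpace ℝ (Fin 4)) ∈ (chartTarget (𝓡 4) p : Set (EuclideanSpace ℝ (Fin 4))) := y.2
  have hi : ((chartRep (𝓡 4) (fun _ : ℝ ↦ g) p 0) y).IsInvertible := hG.isInvertible y hy
  have hu : ContMDiff (𝓡 4) 𝓘(ℝ) ∞ u := hs.contMDiff
  have h1 := MetricCoord.mtrAt_schouten (x := (y : EuclideanSpace ℝ (Fin 4))) hi hW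
  have hE : (finrank ℝ (EuclideanSpace ℝ (Fin 4)) : ℝ) = 4 := by
    rw [finrank_euclideanSpace_fin]; norm_num
  have hB : MetricCoord.mtrAt (chartRep (𝓡 4) (fun _ : ℝ ↦ g) p 0) y
      ((1 / 2 : ℝ) • (MetricCoord.ricAt (chartRep (𝓡 4) (fun _ : ℝ ↦ g) p 0) y - (MetricCoord.scalAt (chartRep (𝓡 4) (fun _ : ℝ ↦ g) p 0) y / 6) • (chartRep (𝓡 4) (fun _ : ℝ ↦ g) p 0) y)) =
      MetricCoord.scalAt (chartRep (𝓡 4) (fun _ : ℝ ↦ g) p 0) y / 6 := by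
    rw [MetricCoord.mtrAt_smul, MetricCoord.mtrAt_sub, MetricCoord.mtrAt_smul,
      MetricCoord.mtrAt_self hi, finrank_euclideanSpace_fin]
    simp only [MetricCoord.scalAt]
    push_cast
    ring
  rw [h1, hB, hE, lapAt_chart g hu p y, gradSqAt_chart g hu p y, scalAt_chart g p y]
  have h2 := IsPathSolution.scalarCurvature_add_pos g h hs (chartInv (𝓡 4) p y)
  linarith

end ChartEquation

section LocalClaim

variable {M : Type*} [TopologicalSpace M] [ChartedSpace (EuclideanSpace ℝ (Fin 4)) M]
  [IsManifold (𝓡 4) ∞ M]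
  (g : PseudoRiemannianMetric (𝓡 4) ∞ (EuclideanSpace ℝ (Fin 4)) (TangentSpace (𝓡 4) : M → Type _)) [g.HasLeviCivita]

set_option maxHeartbeats 4000000 in
/-- **The local Laplacian bound** (Chen 2005, Thm. 1(a) / Cor. 2, read in the chart at `p`): for
a Riemannian `g`, a smooth `q ≥ q₀ > 0` and levels `δ, C₀, C₁` there are a neighbourhood `U` of
`p` and a constant `C` such that for every `t ∈ [δ, 1]` and every path solution `(h, u)` with
`|u| ≤ C₀`, `|∇u|² ≤ C₁`: at every point of `U` where `Δ_g u + |∇u|²_g` attains its maximum over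
`M`, `Δ_g u ≤ C`. The chart at `p` carries the equation to the model space
(`IsPathSolution.chart_equation`, `mtrAt_chart_pos`, the chart dictionary) on a closed ball in
the chart target, where `MetricCoord.IsMetricOn.exists_lapAt_le_at_isLocalMax` applies.
[cite: Chen2005, Thm. 1(a), Cor. 2, §3] [cite: GurskyViaclovsky2003, Prop. 6] -/
theorem exists_nhds_dalembertian_le (hg : g.IsRiemannian) {q : M → ℝ}
    (hq : ContMDiff (𝓡 4) 𝓘(ℝ) ∞ q) {q₀ : ℝ} (hq₀ : 0 < q₀) (hqq₀ : ∀ x, q₀ ≤ q x)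
    (δ C₀ C₁ : ℝ) (hC₁ : 0 ≤ C₁) (p : M) :
    ∃ U ∈ 𝓝 p, ∃ C : ℝ, ∀ t : ℝ, δ ≤ t → t ≤ 1 →
      ∀ (h : PseudoRiemannianMetric (𝓡 4) ∞ (EuclideanSpace ℝ (Fin 4)) (TangentSpace (𝓡 4) : M → Type _)) [h.HasLeviCivita] (u : M → ℝ),
        IsPathSolution g h u t q → (∀ x, |u x| ≤ C₀) → (∀ x, g.gradSq u x ≤ C₁) →
        ∀ x ∈ U, IsMaxOn (fun z ↦ g.dalembertian u z + g.gradSq u z) univ x →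
          g.dalembertian u x ≤ C := by
  have hG := isMetricOn_chartRep g p
  have hE : finrank ℝ (EuclideanSpace ℝ (Fin 4)) = 4 := finrank_euclideanSpace_fin
  have hposV : ∀ y ∈ (chartTarget (𝓡 4) p : Set (EuclideanSpace ℝ (Fin 4))), ∀ v, v ≠ 0 → 0 < (chartRep (𝓡 4) (fun _ : ℝ ↦ g) p 0) y v v :=
    fun y hy v hv ↦ chartRep_pos g hg p hy v hv
  -- a closed ball in the chart target around the image of `p`
  have hpt : extChartAt (𝓡 4) p p ∈ (chartTarget (𝓡 4) p : Set (EuclideanSpace ℝ (Fin 4))) := mem_extChartAt_target p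
  obtain ⟨r, hr, hrV⟩ := Metric.nhds_basis_closedBall.mem_iff.1
    ((isOpen_extChartAt_target (I := 𝓡 4) p).mem_nhds (mem_extChartAt_target (I := 𝓡 4) p))
  have hK : IsCompact (Metric.closedBall (extChartAt (𝓡 4) p p) r) := isCompact_closedBall _ _
  have hKV : Metric.closedBall (extChartAt (𝓡 4) p p) r ⊆ (chartTarget (𝓡 4) p : Set (EuclideanSpace ℝ (Fin 4))) := hrV
  -- the right-hand side data read in the chart
  have hwf : ContDiffOn ℝ ∞ (g.weylNormSq ∘ (extChartAt (𝓡 4) p).symm) (chartTarget (𝓡 4) p : Set (EuclideanSpace ℝ (Fin 4))) :=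
    contDiffOn_comp_extChartAt_symm (g.contMDiff_weylNormSq hg hE) p
  have hqf : ContDiffOn ℝ ∞ (q ∘ (extChartAt (𝓡 4) p).symm) (chartTarget (𝓡 4) p : Set (EuclideanSpace ℝ (Fin 4))) :=
    contDiffOn_comp_extChartAt_symm hq p
  have hwf0 : ∀ y ∈ (chartTarget (𝓡 4) p : Set (EuclideanSpace ℝ (Fin 4))), 0 ≤ (g.weylNormSq ∘ (extChartAt (𝓡 4) p).symm) y :=
    fun y _ ↦ g.weylNormSq_nonneg _
  have hqK : ∀ y ∈ Metric.closedBall (extChartAt (𝓡 4) p p) r, q₀ ≤ (q ∘ (extChartAt (𝓡 4) p).symm) y :=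
    fun y _ ↦ hqq₀ _
  have hn : 2 ≤ finrank ℝ (EuclideanSpace ℝ (Fin 4)) := by rw [hE]; norm_num
  obtain ⟨C, hC⟩ := hG.exists_lapAt_le_at_isLocalMax hn hposV hK hKV hwf hqf hwf0 hq₀ hqK C₀ C₁ δ hC₁
  -- the neighbourhood of `p`
  refine ⟨(extChartAt (𝓡 4) p).source ∩ extChartAt (𝓡 4) p ⁻¹' Metric.ball (extChartAt (𝓡 4) p p) r,
    Filter.inter_mem (extChartAt_source_mem_nhds (I := 𝓡 4) p)
      ((continuousAt_extChartAt (I := 𝓡 4) p).preimage_mem_nhds (Metric.ball_mem_nhds _ hr)), C, ?_⟩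
  intro t ht1 ht2 h _ u hs hu0 hu1 x hx hmax
  have hu : ContMDiff (𝓡 4) 𝓘(ℝ) ∞ u := hs.contMDiff
  have hxs : x ∈ (extChartAt (𝓡 4) p).source := hx.1
  have hyV : extChartAt (𝓡 4) p x ∈ (chartTarget (𝓡 4) p : Set (EuclideanSpace ℝ (Fin 4))) :=
    (extChartAt (𝓡 4) p).map_source hxs
  have hyK : extChartAt (𝓡 4) p x ∈ Metric.closedBall (extChartAt (𝓡 4) p p) r :=
    Metric.ball_subset_closedBall hx.2
  have hxc : x ∈ (chartAt (EuclideanSpace ℝ (Fin 4)) p).source := by rwa [← extChartAt_source (𝓡 4)]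
  have hxy : chartInv (𝓡 4) p ⟨extChartAt (𝓡 4) p x, hyV⟩ = x := chartInv_extChartAt p hxc
  have hfx : (u ∘ (extChartAt (𝓡 4) p).symm) (extChartAt (𝓡 4) p x) = u x := by
    simp only [Function.comp_apply, (extChartAt (𝓡 4) p).left_inv hxs]
  have hf : ContDiffOn ℝ ∞ (u ∘ (extChartAt (𝓡 4) p).symm) (chartTarget (𝓡 4) p : Set (EuclideanSpace ℝ (Fin 4))) :=
    contDiffOn_comp_extChartAt_symm hu p
  have heq : ∀ y ∈ (chartTarget (𝓡 4) p : Set (EuclideanSpace ℝ (Fin 4))),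
      1 / 2 * ((1 + 3 * ((1 - t) * (2 - t))) * MetricCoord.mtrAt (chartRep (𝓡 4) (fun _ : ℝ ↦ g) p 0) y
        ((fun z ↦ MetricCoord.hessAt (chartRep (𝓡 4) (fun _ : ℝ ↦ g) p 0) (u ∘ (extChartAt (𝓡 4) p).symm) z
        + ContinuousLinearMap.smulRightL ℝ (EuclideanSpace ℝ (Fin 4)) (EuclideanSpace ℝ (Fin 4) →L[ℝ] ℝ)
            (fderiv ℝ (u ∘ (extChartAt (𝓡 4) p).symm) z) (fderiv ℝ (u ∘ (extChartAt (𝓡 4) p).symm) z)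
        - (1 / 2 : ℝ) • (MetricCoord.gradSqAt (chartRep (𝓡 4) (fun _ : ℝ ↦ g) p 0) (u ∘ (extChartAt (𝓡 4) p).symm) z • (chartRep (𝓡 4) (fun _ : ℝ ↦ g) p 0) z)
        + (1 / 2 : ℝ) • (MetricCoord.ricAt (chartRep (𝓡 4) (fun _ : ℝ ↦ g) p 0) z - (MetricCoord.scalAt (chartRep (𝓡 4) (fun _ : ℝ ↦ g) p 0) z / 6) • (chartRep (𝓡 4) (fun _ : ℝ ↦ g) p 0) z)) y) ^ 2
        - MetricCoord.pairAt (chartRep (𝓡 4) (fun _ : ℝ ↦ g) p 0) y ((fun z ↦ MetricCoord.hessAt (chartRep (𝓡 4) (fun _ : ℝ ↦ g) p 0) (u ∘ (extChartAt (𝓡 4) p).symm) z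
        + ContinuousLinearMap.smulRightL ℝ (EuclideanSpace ℝ (Fin 4)) (EuclideanSpace ℝ (Fin 4) →L[ℝ] ℝ)
            (fderiv ℝ (u ∘ (extChartAt (𝓡 4) p).symm) z) (fderiv ℝ (u ∘ (extChartAt (𝓡 4) p).symm) z)
        - (1 / 2 : ℝ) • (MetricCoord.gradSqAt (chartRep (𝓡 4) (fun _ : ℝ ↦ g) p 0) (u ∘ (extChartAt (𝓡 4) p).symm) z • (chartRep (𝓡 4) (fun _ : ℝ ↦ g) p 0) z)
        + (1 / 2 : ℝ) • (MetricCoord.ricAt (chartRep (𝓡 4) (fun _ : ℝ ↦ g) p 0) z - (MetricCoord.scalAt (chartRep (𝓡 4) (fun _ : ℝ ↦ g) p 0) z / 6) • (chartRep (𝓡 4) (fun _ : ℝ ↦ g) p 0) z)) y) ((fun z ↦ MetricCoord.hessAt (chartRep (𝓡 4) (fun _ : ℝ ↦ g) p 0) (u ∘ (extChartAt (𝓡 4) p).symm) z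
        + ContinuousLinearMap.smulRightL ℝ (EuclideanSpace ℝ (Fin 4)) (EuclideanSpace ℝ (Fin 4) →L[ℝ] ℝ)
            (fderiv ℝ (u ∘ (extChartAt (𝓡 4) p).symm) z) (fderiv ℝ (u ∘ (extChartAt (𝓡 4) p).symm) z)
        - (1 / 2 : ℝ) • (MetricCoord.gradSqAt (chartRep (𝓡 4) (fun _ : ℝ ↦ g) p 0) (u ∘ (extChartAt (𝓡 4) p).symm) z • (chartRep (𝓡 4) (fun _ : ℝ ↦ g) p 0) z)
        + (1 / 2 : ℝ) • (MetricCoord.ricAt (chartRep (𝓡 4) (fun _ : ℝ ↦ g) p 0) z - (MetricCoord.scalAt (chartRep (𝓡 4) (fun _ : ℝ ↦ g) p 0) z / 6) • (chartRep (𝓡 4) (fun _ : ℝ ↦ g) p 0) z)) y))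
      = 1 / 16 * (g.weylNormSq ∘ (extChartAt (𝓡 4) p).symm) y
        + 1 / 4 * ((q ∘ (extChartAt (𝓡 4) p).symm) y * Real.exp (4 * (u ∘ (extChartAt (𝓡 4) p).symm) y)) :=
    fun y hy ↦ IsPathSolution.chart_equation g h hs p ⟨y, hy⟩
      (fun z ↦ MetricCoord.hessAt (chartRep (𝓡 4) (fun _ : ℝ ↦ g) p 0) (u ∘ (extChartAt (𝓡 4) p).symm) z
        + ContinuousLinearMap.smulRightL ℝ (EuclideanSpace ℝ (Fin 4)) (EuclideanSpace ℝ (Fin 4) →L[ℝ] ℝ)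
            (fderiv ℝ (u ∘ (extChartAt (𝓡 4) p).symm) z) (fderiv ℝ (u ∘ (extChartAt (𝓡 4) p).symm) z)
        - (1 / 2 : ℝ) • (MetricCoord.gradSqAt (chartRep (𝓡 4) (fun _ : ℝ ↦ g) p 0) (u ∘ (extChartAt (𝓡 4) p).symm) z • (chartRep (𝓡 4) (fun _ : ℝ ↦ g) p 0) z)
        + (1 / 2 : ℝ) • (MetricCoord.ricAt (chartRep (𝓡 4) (fun _ : ℝ ↦ g) p 0) z - (MetricCoord.scalAt (chartRep (𝓡 4) (fun _ : ℝ ↦ g) p 0) z / 6) • (chartRep (𝓡 4) (fun _ : ℝ ↦ g) p 0) z)) rfl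
  have hw : ∀ y ∈ (chartTarget (𝓡 4) p : Set (EuclideanSpace ℝ (Fin 4))),
      0 < MetricCoord.mtrAt (chartRep (𝓡 4) (fun _ : ℝ ↦ g) p 0) y ((fun z ↦ MetricCoord.hessAt (chartRep (𝓡 4) (fun _ : ℝ ↦ g) p 0) (u ∘ (extChartAt (𝓡 4) p).symm) z
        + ContinuousLinearMap.smulRightL ℝ (EuclideanSpace ℝ (Fin 4)) (EuclideanSpace ℝ (Fin 4) →L[ℝ] ℝ)
            (fderiv ℝ (u ∘ (extChartAt (𝓡 4) p).symm) z) (fderiv ℝ (u ∘ (extChartAt (𝓡 4) p).symm) z)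
        - (1 / 2 : ℝ) • (MetricCoord.gradSqAt (chartRep (𝓡 4) (fun _ : ℝ ↦ g) p 0) (u ∘ (extChartAt (𝓡 4) p).symm) z • (chartRep (𝓡 4) (fun _ : ℝ ↦ g) p 0) z)
        + (1 / 2 : ℝ) • (MetricCoord.ricAt (chartRep (𝓡 4) (fun _ : ℝ ↦ g) p 0) z - (MetricCoord.scalAt (chartRep (𝓡 4) (fun _ : ℝ ↦ g) p 0) z / 6) • (chartRep (𝓡 4) (fun _ : ℝ ↦ g) p 0) z)) y) :=
    fun y hy ↦ IsPathSolution.mtrAt_chart_pos g h hs p ⟨y, hy⟩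
      (fun z ↦ MetricCoord.hessAt (chartRep (𝓡 4) (fun _ : ℝ ↦ g) p 0) (u ∘ (extChartAt (𝓡 4) p).symm) z
        + ContinuousLinearMap.smulRightL ℝ (EuclideanSpace ℝ (Fin 4)) (EuclideanSpace ℝ (Fin 4) →L[ℝ] ℝ)
            (fderiv ℝ (u ∘ (extChartAt (𝓡 4) p).symm) z) (fderiv ℝ (u ∘ (extChartAt (𝓡 4) p).symm) z)
        - (1 / 2 : ℝ) • (MetricCoord.gradSqAt (chartRep (𝓡 4) (fun _ : ℝ ↦ g) p 0) (u ∘ (extChartAt (𝓡 4) p).symm) z • (chartRep (𝓡 4) (fun _ : ℝ ↦ g) p 0) z)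
        + (1 / 2 : ℝ) • (MetricCoord.ricAt (chartRep (𝓡 4) (fun _ : ℝ ↦ g) p 0) z - (MetricCoord.scalAt (chartRep (𝓡 4) (fun _ : ℝ ↦ g) p 0) z / 6) • (chartRep (𝓡 4) (fun _ : ℝ ↦ g) p 0) z)) rfl
  have hf0 : |(u ∘ (extChartAt (𝓡 4) p).symm) (extChartAt (𝓡 4) p x)| ≤ C₀ := by rw [hfx]; exact hu0 x
  have hγ : MetricCoord.gradSqAt (chartRep (𝓡 4) (fun _ : ℝ ↦ g) p 0) (u ∘ (extChartAt (𝓡 4) p).symm) (extChartAt (𝓡 4) p x) ≤ C₁ := by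
    have h1 := gradSqAt_chart g hu p ⟨extChartAt (𝓡 4) p x, hyV⟩
    rw [hxy] at h1
    rw [h1]
    exact hu1 x
  have hlocmax : IsLocalMax (fun y ↦ MetricCoord.lapAt (chartRep (𝓡 4) (fun _ : ℝ ↦ g) p 0) (u ∘ (extChartAt (𝓡 4) p).symm) y
      + MetricCoord.gradSqAt (chartRep (𝓡 4) (fun _ : ℝ ↦ g) p 0) (u ∘ (extChartAt (𝓡 4) p).symm) y) (extChartAt (𝓡 4) p x) := by
    refine Filter.eventually_of_mem ((isOpen_extChartAt_target (I := 𝓡 4) p).mem_nhds hyV) fun z hz ↦ ?_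
    have h1 := lapAt_chart g hu p ⟨z, hz⟩
    have h2 := gradSqAt_chart g hu p ⟨z, hz⟩
    have h3 := lapAt_chart g hu p ⟨extChartAt (𝓡 4) p x, hyV⟩
    have h4 := gradSqAt_chart g hu p ⟨extChartAt (𝓡 4) p x, hyV⟩
    rw [hxy] at h3 h4
    simp only [h1, h2, h3, h4]
    exact hmax (mem_univ _)
  have hfin := hC t ht1 ht2 (u ∘ (extChartAt (𝓡 4) p).symm) (fun z ↦ MetricCoord.hessAt (chartRep (𝓡 4) (fun _ : ℝ ↦ g) p 0) (u ∘ (extChartAt (𝓡 4) p).symm) z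
        + ContinuousLinearMap.smulRightL ℝ (EuclideanSpace ℝ (Fin 4)) (EuclideanSpace ℝ (Fin 4) →L[ℝ] ℝ)
            (fderiv ℝ (u ∘ (extChartAt (𝓡 4) p).symm) z) (fderiv ℝ (u ∘ (extChartAt (𝓡 4) p).symm) z)
        - (1 / 2 : ℝ) • (MetricCoord.gradSqAt (chartRep (𝓡 4) (fun _ : ℝ ↦ g) p 0) (u ∘ (extChartAt (𝓡 4) p).symm) z • (chartRep (𝓡 4) (fun _ : ℝ ↦ g) p 0) z)
        + (1 / 2 : ℝ) • (MetricCoord.ricAt (chartRep (𝓡 4) (fun _ : ℝ ↦ g) p 0) z - (MetricCoord.scalAt (chartRep (𝓡 4) (fun _ : ℝ ↦ g) p 0) z / 6) • (chartRep (𝓡 4) (fun _ : ℝ ↦ g) p 0) z)) hf rfl heq hw (extChartAt (𝓡 4) p x) hyK hf0 hγ hlocmax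
  have h3 := lapAt_chart g hu p ⟨extChartAt (𝓡 4) p x, hyV⟩
  rw [hxy] at h3
  rwa [h3] at hfin

end LocalClaim

section Global

variable {M : Type*} [TopologicalSpace M] [CompactSpace M] [ChartedSpace (EuclideanSpace ℝ (Fin 4)) M]
  [IsManifold (𝓡 4) ∞ M]
  (g : PseudoRiemannianMetric (𝓡 4) ∞ (EuclideanSpace ℝ (Fin 4)) (TangentSpace (𝓡 4) : M → Type _)) [g.HasLeviCivita]

/-- **The Laplacian bound** (hypothesis `hΔ` of `hessianEstimate_of_dalembertianEstimate`):
on a compact `4`-manifold, along the weighted `σ₂`-path with `C⁰` and `C¹` bounds,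
`Δ_g u ≤ C₃` with `C₃` independent of `t ∈ [δ, 1]` (Chen 2005, §3: the maximum principle for
`Δu + |∇u|²`, at a maximum point read in one of finitely many charts covering `M`).
[cite: Chen2005, Thm. 1(a), Cor. 2, §3] [cite: GurskyViaclovsky2003, Prop. 6] -/
theorem dalembertian_le_of_isPathSolution (hg : g.IsRiemannian) (q : M → ℝ) (δ C₀ C₁ : ℝ)
    (hq : ContMDiff (𝓡 4) 𝓘(ℝ) ∞ q) (hq0 : ∀ x, 0 < q x) :
    ∃ C₃ : ℝ, ∀ t : ℝ, δ ≤ t → t ≤ 1 →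
      ∀ (h : PseudoRiemannianMetric (𝓡 4) ∞ (EuclideanSpace ℝ (Fin 4)) (TangentSpace (𝓡 4) : M → Type _)) [h.HasLeviCivita] (u : M → ℝ),
        IsPathSolution g h u t q → (∀ x, |u x| ≤ C₀) → (∀ x, g.gradSq u x ≤ C₁) →
        ∀ x, g.dalembertian u x ≤ C₃ := by
  classical
  rcases isEmpty_or_nonempty M with hM | hM
  · exact ⟨0, fun t _ _ h _ u _ _ _ x ↦ (IsEmpty.false x).elim⟩
  · -- `q` attains a positive minimum
    obtain ⟨x₁, -, hx₁⟩ := isCompact_univ.exists_isMinOn univ_nonempty hq.continuous.continuousOn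
    have hqq₀ : ∀ x, q x₁ ≤ q x := fun x ↦ hx₁ (mem_univ x)
    -- local bounds and a finite subcover
    choose U hU C hC using fun p ↦ exists_nhds_dalembertian_le g hg hq (hq0 x₁) hqq₀ δ C₀ (max C₁ 0)
      (le_max_right _ _) p
    obtain ⟨s, -, hs⟩ := isCompact_univ.elim_nhds_subcover U fun p _ ↦ hU p
    refine ⟨∑ p ∈ s, |C p| + max C₁ 0, ?_⟩
    intro t ht1 ht2 h _ u hsol hu0 hu1 x
    have hu : ContMDiff (𝓡 4) 𝓘(ℝ) ∞ u := hsol.contMDiff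
    have hu1' : ∀ z, g.gradSq u z ≤ max C₁ 0 := fun z ↦ (hu1 z).trans (le_max_left _ _)
    -- a maximum point of `Δu + |∇u|²`
    have hLc : Continuous fun z ↦ g.dalembertian u z + g.gradSq u z := by
      refine (continuous_dalembertian g (hu.of_le (by norm_cast))).add ?_
      exact continuous_innerDual_mvfderiv g (hu.of_le (by norm_cast)) (hu.of_le (by norm_cast))
    obtain ⟨x₀, -, hx₀⟩ := isCompact_univ.exists_isMaxOn univ_nonempty hLc.continuousOn
    obtain ⟨p, hp, hxp⟩ := Set.mem_iUnion₂.1 (hs (mem_univ x₀))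
    have h1 : g.dalembertian u x₀ ≤ C p := hC p t ht1 ht2 h u hsol hu0 hu1' x₀ hxp hx₀
    have h2 : C p ≤ ∑ p ∈ s, |C p| :=
      (le_abs_self _).trans (Finset.single_le_sum (f := fun p ↦ |C p|) (fun _ _ ↦ abs_nonneg _) hp)
    have h3 : g.dalembertian u x + g.gradSq u x ≤ g.dalembertian u x₀ + g.gradSq u x₀ :=
      hx₀ (mem_univ x)
    have h4 : 0 ≤ g.gradSq u x := by
      rw [PseudoRiemannianMetric.gradSq, innerDual_eq_val_sharp_sharp]
      set v := g.sharp x (mvfderiv (𝓡 4) u x).toLinearMap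
      by_cases hv : v = 0
      · rw [hv]; simp
      · exact (hg x v hv).le
    linarith [hu1' x₀]

end Global

/-! ## Assembly: the named fact -/

/-- **Gursky–Viaclovsky 2003, Prop. 6 (`C²` estimate along the weighted `σ₂`-path), proved.**
Step 1 (`hessianEstimate_of_dalembertianEstimate`: the cone condition and `|W|² = (tr W)² − 2σ₂(W)`
reduce the Hessian bound to a Laplacian bound) and step 2 (`dalembertian_le_of_isPathSolution`:
Chen's maximum principle for `Δu + |∇u|²`, IMRN 2005:63, Thm. 1(a) / Cor. 2, §3, in charts).
[cite: GurskyViaclovsky2003, Prop. 6] [cite: Chen2005, Thm. 1(a), Cor. 2, §3] -/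
theorem _root_.Literature.Geometry.Riemannian.gurskyViaclovsky_hessianEstimate_weighted_four_holds :
    gurskyViaclovsky_hessianEstimate_weighted_four :=
  hessianEstimate_of_dalembertianEstimate fun M _ _ _ _ _ _ g _ hg q δ C₀ C₁ hq hq0 _ ↦
    dalembertian_le_of_isPathSolution (M := M) g hg q δ C₀ C₁ hq hq0

end Literature.Geometry.Riemannian.GurskyViaclovskyPath

end
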